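import Literature.MathematicalPhysics.QuantumFieldTheory.Balaban1983to89.B9Thm310TransposedCommutatorBForms
import Literature.MathematicalPhysics.QuantumFieldTheory.Balaban1983to89.B9Thm310CommutatorDataOfPlaquettes
import Literature.MathematicalPhysics.QuantumFieldTheory.Balaban1983to89.B9Thm37TransposedCommutator

/-!
# `Balaban1983to89.B9Thm310TransposedCommutatorB` — T. Bałaban, *Propagators for lattice gauge theories in a background field*, Commun. Math. Phys.
# **99** (1985) 389–434 [Balaban1985BackgroundPropagators], Sect. C pp. 409, 413–415: THE TRANSPOSED (3.89) OF THE BOND SECTOR — the commutator term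
# `h_□·G_□(U)·K(h_□)(U)` of the transposed expansion (3.105), `(Σ_□h_□G_□h_□)Δ_a = 1 − V`, bounded POINTWISE OVER THE INVARIANT CLASS by `O(M⁻¹)B₀e^{−δd}`
# for any bond cube letter `G_□ = O` whose (3.42)₁,₃ entries are displayed (sub-row G-B9-LETTERS, module M5.7, PLAN item 5 «hV» family 1, file T2 = sizes;
# the bond-sector twin of p21's `B9Thm37TransposedCommutator` §2–§5)

statement-level skeleton of published theorems with citation tags; proofs where landed; nothing here is a claim about the Yang–Mills mass gap

PDF held: `paper:balaban1985-cmp99-background-propagators` (journal page = PDF page + 388); pp. 396–399, 404, 409–410, 413–415 read from the held text layer;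
[4] = [Balaban1984PropagatorsII] pp. 224, 230–235, 247.

THE PRINT.  p. 409 (3.89) *«|(K(h_□)G′_□h_□λ)(x)| ≦ O(M⁻¹)e^{−δ₀(Lʲη)⁻¹|y−y′|}|λ|»* (x ∈ Δ(y), supp λ ⊂ Δ(y′), y, y′ ∈ □ ∈ 𝒟_j; the cell's composite constant
`O(1)(M⁻¹ + e^{−δ₀M})B₀e^{−δ₀d(y,y′)}` used below is our reading of (3.89) with explicit constants, not print's display), *«It is exactly the bound (2.44) of [4]»*; p. 414 *«The operator K(h_□)G_□h_□
satisfies the inequality (3.89), hence it is small»*, l. 1–3 *«first order differential operators with coefficients determined by derivatives of the function h.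
They are of the order O(M⁻¹), or O(M⁻²), if considered on a proper scale. The operator Δ′ is small and local by (3.10), hence the commutator [Δ′, h] gives the
factor O(M⁻¹) too»*; p. 415 *«we use again the flexibility of these expansions»*; Thm 3.3 p. 399 with (3.42) p. 397 (first and third members `|G(U)|`,
`|G(U)∇*_U|`); (3.35) p. 396 (*«|∇^η A| < O(1)Mα₀(Lʲη)⁻² on □»*) and (3.69) p. 404 (plaquette variables close to `1` at the level of the cube); [4] (2.44) p. 230,
(2.51)–(2.52) p. 232 *«λ = Σ_{y′}Δ(y′)λ»*, Lemma 2.1 (2.61) p. 234, p. 235 (the window of `□⁺`), p. 247 *«|∂h_□| ≤ O(1)(MLʲη)⁻¹, |Δh_□| ≤ O(1)(MLʲη)⁻²»*.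

WHY THIS FILE (cell context).  M5.7's right entry (3.42)₃ for def-Y's `G(U)` displays the scale-weighted majorant `hV` of the transposed remainder, whose first
family is `−Σ_□h_□G_□K(h_□)`.  File T1 (`B9Thm310TransposedCommutatorBForms.KhBY_apply_transposed`) wrote `K(h)Λ` as `Σ ∇*_{U,μ}(explicit) + Σ (explicit
zeroth order) + [h,Δ′₂]Λ + [h,Q*aQ]Λ`.  This file sizes every term against the cube letter's (3.42)₁ (`h342₀`) and (3.42)₃ (`h342₂`) entries over the class: the
`∇*`-inputs through `O∇*_{U,μ}` after the input-side block split of [4] (2.51)–(2.52) (the inputs live two lattice steps off `supp Λ`), at the cost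
`ℓ(y)·|c_f|·|∂h_□| = L^{lev}·|∂h_□| ≤ (5∕8)C1F∕M_h` («O(M⁻¹)», uniformly in the cube's level, since the output carries `h_□`); the zeroth-order terms through
`O` itself, their second differences `ℓ(y)²c_f²|∂²h_□| ≤ (5∕8)²C2∕M_h²` («O(M⁻²)») and their plaquette factors READ OFF ONE level-weighted datum
`‖U(∂p) − 1‖ ≤ δ̂·(L^{lev p₀})⁻²` (E′₅; the input plaquettes sit in the window `lev ≥ j − 3` because a difference of `h_□` is non-zero next to them, so
`ℓ(y)²c_f²·(L^{lev})⁻² ≤ L⁸`); `[h,Δ′₂]Λ` by E′₁-loc's `norm_cutCommR_curv2Y_hTY_apply_le_loc`; `[h,Q*aQ]Λ` by D′₃a's `norm_cutCommR_QsY_aY_QY_hTY_apply_le` with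
the weight band ([4] (2.16)) and E′₂b's column sum `Σ_y|Q*(b,y)| ≤ 2(L^{d+1})^{−lev b}`, split over the indices within `2L+4` of the input block.
★★ `norm_hTY_O_KhBY_apply_le`: `‖h_□(b₋)·(O K(h_□)(U)Λ)(b)‖ ≤ θ_Tᴮ·e^{−δd(y,y′)}·|J|`, every term of `θ_Tᴮ` carrying `M_h⁻¹` or `M_h⁻²`, and depending on
`d, L, B₀, b₁, δ, δ̂` and the two neighbourhood counts only.  Nothing of (3.42) for the cube letter, of Thm 3.10 ∕ 3.3, of the counts ([4] (2.61)) is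
asserted: displayed or cited by name; file T3 feeds M5.7's `hV`.  Nothing continuum ∕ OS ∕ mass gap ∕ Clay; YM mass gap NOT proved by any of this (Track A
conditional rung).  `--supports stmt-QuantumFields-19200`.  Net new unproved facts: 0 (theorems only).
-/

noncomputable section

namespace Literature.MathematicalPhysics.QuantumFieldTheory.Balaban1983to89.B9Thm310TransposedCommutatorB

open Node00
open B9Thm310TransposedCommutatorBForms
open B9Thm37CubeCoverCommutators (cutMulY cutMulY_apply hTY hTY_apply)
open B9Thm37CubeCoverCommutatorSizes (side_conditions four_le_P' abs_hTY_shiftY_sub_le abs_hTY_shiftY_symm_sub_le)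
open B9Thm37CubeCoverCommutatorSizesGrad (C1F_div_bigSide_eq C2F_div_bigSide_sq_eq)
open B9Thm37CommutatorBound389 (norm_cutMulY_le_of_le lev_le_succ_of_touch lev_le_succ_of_touch' torusSupNorm_sub_shiftY_le_one geo9K_dist_eq geo9K_len_eq
  levY_eq_lvl_of_blkOf_eq blkOf_fst_fst)
open B9Thm37CutoffGradTerms (mem_QT_and_lev_of_near torusSupNorm_sub_self_le_one len_eq_pow_mul_eta)
open B9Thm37TransposedCommutator (lvl_ge_of_mem_QT abs_hTY_second_diff_le)
open B9Eq3104CutoffCommutators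
open B9Eq3104CommutatorGradFormDD (shiftY_symm_shiftY_comm shiftY_shiftY_symm shiftY_symm_shiftY)
open B9Eq3104CommutatorSizesDD (abs_hTY_mixed_le C2X_div_bigSide_sq_eq)
open B9Eq3104CommutatorSizesCurl (jIns norm_jIns_le)
open B9Eq3104CommutatorSizesLoc (norm_cutCommR_curv2Y_hTY_apply_le_loc)
open B9Eq3104CommutatorSizesAvg (norm_cutCommR_QsY_aY_QY_hTY_apply_le aY_apply)
open B9Eq3104CommutatorSupport (trLiftY_apply_eq_zero_of cutCommR_trLiftY_apply_eq_zero_of aY_apply_eq_zero_of cutCommR_curv2Y_apply_eq_zero_of touch_symm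
  touch_src_edgeY dist_blkOf_le_one_of_touch' dist_bondT_triangle qwt_ne_zero_of_qsK_ne_zero qwt_ne_zero_of_qK_ne_zero levY_src_bounds_of_qwt_ne_zero
  dist_blkV1_beta_le_of_qwt_ne_zero levY_blkCornerY_beta)
open B9Thm310CommutatorBound389B (abs_le_supNorm_inr supNorm_inr_nonneg abs_cf_eq_of_eta pow_levY_le_abs_cf step_facts two_step_facts w_le_of_band b1_pos
  sum_abs_qsK_le)
open B9Thm310CommutatorBound389BLoc (inv_pow_sq_le_of_le_succ)
open B9Thm310CommutatorDataOfPlaquettes (hP_of_plaquettes hI_of_plaquettes hRe_of_bicontractive bicontr_holY norm_reHolY_sub_one_le)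
open B9GradViaDivLettersAtPins (Jb Jb_apply)
open B6KLevelCensusIndexV1 (KIdx)
open B6Ineq2142KLevelV1 (β lvl qwt)
open B6GlobalChartV1 (PV blkV1)
open B4TorusKernel.MultiPeriod (torusSupNorm)
open B6Geom246MultiLevelBox (bset blkOf)
open B6Geom246MultiLevelTorus (bondT)
open B6MultiLevelBoxOperator (bigSide)
open B6Cover236MultiLevelBlocks (cubes)
open B6Partition118KLevelTorus (abs_hT_le_one)
open B6Partition118KLevelTorusCentral (QT)
open B6Partition118KLevelFineSizes (C1F C1F_nonneg)
open B6Partition118KLevelFineSecond (C2F C2F_nonneg)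
open B6Partition118KLevelFineMixed (C2X C2X_bounds)
open B6Partition118KLevelTorusBinders (sLipT sLipT_nonneg)
open B6RandomWalk (Ineq261)
open B9Thm34Ext (toB6)
open B9GeoNormsKLevelV1 (geo9K geo9K_supNorm_nonneg)
open B9GeoLemma21KLevelV1 (geo9K_dist_triangle geo9K_dist_comm one_le_Mh one_le_P)
open Node00.OpsYNablaBridge (chartY shiftY_chartY shiftY_symm_chartY bondCompY bondCompY_apply cdS_apply)
open B9CoReadingCoords (cdsBₗ cdsBₗ_apply)
open B9Eq39Adjoint (R R_zero R_sub R_smul plaqU)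
open B9Eq310Hermitian (norm_R_le)
open scoped Matrix

variable {𝔸 : Type} [NormedRing 𝔸] [NormedAlgebra ℂ 𝔸] [CompleteSpace 𝔸]
variable {d ℓ : ℕ} {hd : 1 ≤ d + 1} {hL : Odd (ℓ + 1) ∧ 1 < ℓ + 1} {b₀ b₁ : ℝ}
variable (i : KIdx d ℓ hd hL b₀ b₁)

/-! ## §1 The input-side block split of the bond sector ([4] (2.51)–(2.52)) and the neighbourhood count from (2.61) -/

section Split

variable {δ : ℝ}

omit [CompleteSpace 𝔸] in
/-- ★ **THE INPUT-SIDE BLOCK SPLIT, BOND SECTOR**: let `Φ` be an ℝ-linear operator on bond functions whose value at `x` on the class of every profile `G`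
supported in a block `Δ(βa)` is at most `K·e^{−δd(y,a)}·|G|` (a displayed entry of the cube letter), `0 ≤ δ`, and let `Ψ` be bounded by `C` and vanish at
every bond whose block is farther than `r` from `βy′`.  Splitting `Ψ = Σ_{a : d(a,y′) ≤ r} 1_{Δ(βa)}Ψ` into at most `m` block pieces gives
`‖(ΦΨ)(x)‖ ≤ m·e^{δr}·K·e^{−δd(y,y′)}·C`. [cite: Balaban1984PropagatorsII, (2.51)–(2.52) p.232 («λ = Σ_{y′}Δ(y′)λ»), (2.61) p.234; Balaban1985BackgroundPropagators, (3.42) p.397] -/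
theorem norm_apply_le_of_splitB (hδ : 0 ≤ δ) (ιB : BlkY i → IBondY i) (hι : ∀ s, β i.hN i.D i.hk (ιB s) = s)
    (Φ : (FBondY i → 𝔸) →ₗ[ℝ] (FBondY i → 𝔸)) {K : ℝ} (hK : 0 ≤ K) (y y' : IBondY i) (x : FBondY i)
    (hΦ : ∀ (G : FBondY i → ℝ) (a : IBondY i), (geo9K i).suppIn (Sum.inr G) a →
      ∀ Ψ' : FBondY i → 𝔸, (∀ w, ‖Ψ' w‖ ≤ |G w|) → ‖Φ Ψ' x‖ ≤ K * Real.exp (-(δ * (geo9K i).dist y a)) * (geo9K i).supNorm (Sum.inr G))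
    {r : ℝ} (T : IBondY i → Finset (IBondY i)) (hT : ∀ a y' : IBondY i, (geo9K i).dist a y' ≤ r → a ∈ T y')
    {mN : ℝ} (hnbr : ∀ y' : IBondY i, ((T y').card : ℝ) ≤ mN)
    (Ψ : FBondY i → 𝔸) {C : ℝ} (hC : 0 ≤ C) (hΨC : ∀ w, ‖Ψ w‖ ≤ C)
    (hnear : ∀ w, Ψ w ≠ 0 → (geo9K i).dist (ιB (blkV1 i.hN i.D w)) y' ≤ r) :
    ‖Φ Ψ x‖ ≤ mN * Real.exp (δ * r) * K * Real.exp (-(δ * (geo9K i).dist y y')) * C := by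
  classical
  set Ψp : IBondY i → FBondY i → 𝔸 := fun a w => if ιB (blkV1 i.hN i.D w) = a then Ψ w else 0 with hΨp
  set Fp : IBondY i → FBondY i → ℝ := fun a w => if ιB (blkV1 i.hN i.D w) = a then (if Ψ w = 0 then 0 else C) else 0 with hFp
  -- `Ψ` is the sum of its pieces over `T y′`
  have hsplit : Ψ = ∑ a ∈ T y', Ψp a := by
    funext w
    rw [Finset.sum_apply]
    show Ψ w = ∑ a ∈ T y', (if ιB (blkV1 i.hN i.D w) = a then Ψ w else 0)
    by_cases hw : Ψ w = 0
    · rw [hw]; symm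
      exact Finset.sum_eq_zero fun a _ => ite_self 0
    · rw [Finset.sum_ite_eq, if_pos (hT _ _ (hnear w hw))]
  have hsum : Φ Ψ x = ∑ a ∈ T y', Φ (Ψp a) x := by rw [hsplit, map_sum, Finset.sum_apply]
  -- each piece
  have hpiece : ∀ a ∈ T y', ‖Φ (Ψp a) x‖ ≤ Real.exp (δ * r) * K * Real.exp (-(δ * (geo9K i).dist y y')) * C := by
    intro a _
    by_cases ha : (geo9K i).dist a y' ≤ r
    · have hcls : ∀ w, ‖Ψp a w‖ ≤ |Fp a w| := fun w => by
        show ‖(if ιB (blkV1 i.hN i.D w) = a then Ψ w else 0)‖ ≤ |(if ιB (blkV1 i.hN i.D w) = a then (if Ψ w = 0 then 0 else C) else 0)|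
        split_ifs with h1 h2
        · rw [h2, norm_zero, abs_zero]
        · rw [abs_of_nonneg hC]; exact hΨC w
        · rw [norm_zero, abs_zero]
      have hsa : (geo9K i).suppIn (Sum.inr (Fp a)) a := by
        intro w hw
        have hwa : ιB (blkV1 i.hN i.D w) = a := by
          by_contra hne
          exact hw (show (if ιB (blkV1 i.hN i.D w) = a then (if Ψ w = 0 then (0 : ℝ) else C) else 0) = 0 by rw [if_neg hne])
        show blkV1 i.hN i.D w = β i.hN i.D i.hk a
        rw [← hwa, hι]
      have hsup : (geo9K i).supNorm (Sum.inr (Fp a)) ≤ C := by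
        refine Real.iSup_le (fun w => ?_) hC
        show |(if ιB (blkV1 i.hN i.D w) = a then (if Ψ w = 0 then (0 : ℝ) else C) else 0)| ≤ C
        split_ifs
        · rw [abs_zero]; exact hC
        · rw [abs_of_nonneg hC]
        · rw [abs_zero]; exact hC
      have h1 := hΦ (Fp a) a hsa (Ψp a) hcls
      have hexp : Real.exp (-(δ * (geo9K i).dist y a)) ≤ Real.exp (δ * r) * Real.exp (-(δ * (geo9K i).dist y y')) := by
        rw [← Real.exp_add]
        refine Real.exp_le_exp.2 ?_
        have htri := geo9K_dist_triangle i y a y'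
        have h2 : δ * (geo9K i).dist y y' ≤ δ * ((geo9K i).dist y a + r) := mul_le_mul_of_nonneg_left (htri.trans (by linarith)) hδ
        nlinarith
      calc ‖Φ (Ψp a) x‖ ≤ K * Real.exp (-(δ * (geo9K i).dist y a)) * (geo9K i).supNorm (Sum.inr (Fp a)) := h1
        _ ≤ K * (Real.exp (δ * r) * Real.exp (-(δ * (geo9K i).dist y y'))) * C :=
          mul_le_mul (mul_le_mul_of_nonneg_left hexp hK) hsup (geo9K_supNorm_nonneg i _) (by positivity)
        _ = _ := by ring
    · have h0 : Ψp a = 0 := by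
        funext w
        show (if ιB (blkV1 i.hN i.D w) = a then Ψ w else 0) = 0
        split_ifs with hwa
        · by_contra hne
          have h1 := hnear w hne
          rw [hwa] at h1
          exact ha h1
        · rfl
      rw [h0, map_zero, Pi.zero_apply, norm_zero]; positivity
  have hP0 : 0 ≤ Real.exp (δ * r) * K * Real.exp (-(δ * (geo9K i).dist y y')) * C := by positivity
  have hmN : ((T y').card : ℝ) ≤ mN := hnbr y'
  rw [hsum]
  calc ‖∑ a ∈ T y', Φ (Ψp a) x‖ ≤ ∑ a ∈ T y', ‖Φ (Ψp a) x‖ := norm_sum_le _ _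
    _ ≤ ∑ a ∈ T y', Real.exp (δ * r) * K * Real.exp (-(δ * (geo9K i).dist y y')) * C := Finset.sum_le_sum hpiece
    _ = ((T y').card : ℝ) * (Real.exp (δ * r) * K * Real.exp (-(δ * (geo9K i).dist y y')) * C) := by rw [Finset.sum_const, nsmul_eq_mul]
    _ ≤ mN * (Real.exp (δ * r) * K * Real.exp (-(δ * (geo9K i).dist y y')) * C) := mul_le_mul_of_nonneg_right hmN hP0
    _ = _ := by ring

variable [Fintype (geo9K i).Site] {Rr : ℝ} {Hp : Prop}

omit [NormedRing 𝔸] [NormedAlgebra ℂ 𝔸] [CompleteSpace 𝔸] in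
/-- **THE NEIGHBOURHOOD COUNT FROM (2.61), ANY RADIUS**: the number of carrier indices within distance `r` of an index is at most `e^{αδr}·c₁(α)` (`αδ ≥ 0`).
[cite: Balaban1984PropagatorsII, Lemma 2.1 (2.61) p.234, (2.46) p.231] -/
theorem card_ball_le_of_ineq261 (d' : ℕ) {δ₀ α : ℝ} (hαδ : 0 ≤ α * δ₀) (h261 : Ineq261 d' (toB6 (geo9K i) Rr Hp) δ₀ α) (r : ℝ)
    (y' : (geo9K i).Site) :
    (((Finset.univ.filter fun a : (geo9K i).Site => (geo9K i).dist a y' ≤ r).card : ℕ) : ℝ) ≤ Real.exp (α * δ₀ * r) * B6.c1 d' δ₀ α := by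
  classical
  have hrow : (∑ a : (geo9K i).Site, Real.exp (-(α * δ₀ * (geo9K i).dist y' a))) ≤ B6.c1 d' δ₀ α := h261 y'
  have h1 : ∀ a : (geo9K i).Site, (if (geo9K i).dist a y' ≤ r then (1 : ℝ) else 0)
      ≤ Real.exp (α * δ₀ * r) * Real.exp (-(α * δ₀ * (geo9K i).dist y' a)) := by
    intro a
    by_cases h : (geo9K i).dist a y' ≤ r
    · rw [if_pos h, ← Real.exp_add, geo9K_dist_comm i y' a]
      exact Real.one_le_exp (by nlinarith)
    · rw [if_neg h]; positivity
  calc (((Finset.univ.filter fun a : (geo9K i).Site => (geo9K i).dist a y' ≤ r).card : ℕ) : ℝ)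
      = ∑ a : (geo9K i).Site, (if (geo9K i).dist a y' ≤ r then (1 : ℝ) else 0) := by
        rw [Finset.card_filter]; push_cast; rfl
    _ ≤ ∑ a : (geo9K i).Site, Real.exp (α * δ₀ * r) * Real.exp (-(α * δ₀ * (geo9K i).dist y' a)) := Finset.sum_le_sum fun a _ => h1 a
    _ = Real.exp (α * δ₀ * r) * ∑ a : (geo9K i).Site, Real.exp (-(α * δ₀ * (geo9K i).dist y' a)) := by rw [Finset.mul_sum]
    _ ≤ Real.exp (α * δ₀ * r) * B6.c1 d' δ₀ α := mul_le_mul_of_nonneg_left hrow (Real.exp_nonneg _)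

end Split

/-! ## §2 The two readings of the cube letter over the class, after the split: `O∇*_{U,ν}Ψ` by (3.42)₃ and `OΨ` by (3.42)₁ -/

section Readings

variable (U : CfgY 𝔸 i) (O : (FBondY i → 𝔸) →ₗ[ℂ] (FBondY i → 𝔸)) {B₀ δ : ℝ}

/-- ★ **`O∇*_{U,ν}Ψ` FOR AN INPUT WITHIN `r` BLOCKS OF `Δ(βy′)`**: from (3.42)₃ of `O` over the class (`h342₂`) and the split,
`‖(O∇*_{U,ν}Ψ)(x)‖ ≤ m·e^{δr}·B₀ℓ(y)·e^{−δd(y,y′)}·C` for `x ∈ Δ(βy)`, `‖Ψ‖ ≤ C`, `Ψ` vanishing beyond `r`.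
[cite: Balaban1985BackgroundPropagators, Thm 3.3 p.399 with (3.42) p.397 (third member); Balaban1984PropagatorsII, (2.51)–(2.52) p.232] -/
theorem norm_O_cdsB_le_of_near (hB₀ : 0 ≤ B₀) (hδ : 0 ≤ δ) (ιB : BlkY i → IBondY i) (hι : ∀ s, β i.hN i.D i.hk (ιB s) = s)
    (h342₂ : ∀ (J : FBondY i → ℝ) (y y' : IBondY i), (geo9K i).suppIn (Sum.inr J) y' →
      ∀ Λ : FBondY i → 𝔸, (∀ x, ‖Λ x‖ ≤ |J x|) → ∀ (x : FBondY i) (ν : Fin (d + 1)), blkV1 i.hN i.D x = β i.hN i.D i.hk y →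
        ‖O (cdsB i U ν Λ) x‖ ≤ B₀ * (geo9K i).len y * Real.exp (-(δ * (geo9K i).dist y y')) * (geo9K i).supNorm (Sum.inr J))
    {r : ℝ} (T : IBondY i → Finset (IBondY i)) (hT : ∀ a y' : IBondY i, (geo9K i).dist a y' ≤ r → a ∈ T y')
    {mN : ℝ} (hnbr : ∀ y' : IBondY i, ((T y').card : ℝ) ≤ mN)
    (y y' : IBondY i) (Ψ : FBondY i → 𝔸) {C : ℝ} (hC : 0 ≤ C) (hΨC : ∀ w, ‖Ψ w‖ ≤ C)
    (hnear : ∀ w, Ψ w ≠ 0 → (geo9K i).dist (ιB (blkV1 i.hN i.D w)) y' ≤ r) (x : FBondY i) (ν : Fin (d + 1)) (hx : blkV1 i.hN i.D x = β i.hN i.D i.hk y) :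
    ‖O (cdsB i U ν Ψ) x‖ ≤ mN * Real.exp (δ * r) * (B₀ * (geo9K i).len y) * Real.exp (-(δ * (geo9K i).dist y y')) * C := by
  have hleny : 0 ≤ (geo9K i).len y := (B6KLevelCensusIndexV1.len_pos i y).le
  have hΦ : ∀ (G : FBondY i → ℝ) (a : IBondY i), (geo9K i).suppIn (Sum.inr G) a →
      ∀ Ψ' : FBondY i → 𝔸, (∀ w, ‖Ψ' w‖ ≤ |G w|) → ‖(O.restrictScalars ℝ ∘ₗ cdsBₗ i U ν) Ψ' x‖
        ≤ B₀ * (geo9K i).len y * Real.exp (-(δ * (geo9K i).dist y a)) * (geo9K i).supNorm (Sum.inr G) :=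
    fun G a hsa Ψ' hΨ' => h342₂ G y a hsa Ψ' hΨ' x ν hx
  exact norm_apply_le_of_splitB i hδ ιB hι (O.restrictScalars ℝ ∘ₗ cdsBₗ i U ν) (by positivity) y y' x hΦ T hT hnbr Ψ hC hΨC hnear

omit [CompleteSpace 𝔸] in
/-- ★ **`OΨ` FOR AN INPUT WITHIN `r` BLOCKS OF `Δ(βy′)`**: from (3.42)₁ of `O` over the class (`h342₀`) and the split,
`‖(OΨ)(x)‖ ≤ m·e^{δr}·B₀ℓ(y)²·e^{−δd(y,y′)}·C`. [cite: Balaban1985BackgroundPropagators, Thm 3.3 p.399 with (3.42) p.397 (first member); Balaban1984PropagatorsII, (2.51)–(2.52) p.232] -/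
theorem norm_O_le_of_near (O : (FBondY i → 𝔸) →ₗ[ℂ] (FBondY i → 𝔸)) (hB₀ : 0 ≤ B₀) (hδ : 0 ≤ δ) (ιB : BlkY i → IBondY i)
    (hι : ∀ s, β i.hN i.D i.hk (ιB s) = s)
    (h342₀ : ∀ (J : FBondY i → ℝ) (y y' : IBondY i), (geo9K i).suppIn (Sum.inr J) y' →
      ∀ Λ : FBondY i → 𝔸, (∀ x, ‖Λ x‖ ≤ |J x|) → ∀ x : FBondY i, blkV1 i.hN i.D x = β i.hN i.D i.hk y →
        ‖O Λ x‖ ≤ B₀ * (geo9K i).len y ^ 2 * Real.exp (-(δ * (geo9K i).dist y y')) * (geo9K i).supNorm (Sum.inr J))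
    {r : ℝ} (T : IBondY i → Finset (IBondY i)) (hT : ∀ a y' : IBondY i, (geo9K i).dist a y' ≤ r → a ∈ T y')
    {mN : ℝ} (hnbr : ∀ y' : IBondY i, ((T y').card : ℝ) ≤ mN)
    (y y' : IBondY i) (Ψ : FBondY i → 𝔸) {C : ℝ} (hC : 0 ≤ C) (hΨC : ∀ w, ‖Ψ w‖ ≤ C)
    (hnear : ∀ w, Ψ w ≠ 0 → (geo9K i).dist (ιB (blkV1 i.hN i.D w)) y' ≤ r) (x : FBondY i) (hx : blkV1 i.hN i.D x = β i.hN i.D i.hk y) :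
    ‖O Ψ x‖ ≤ mN * Real.exp (δ * r) * (B₀ * (geo9K i).len y ^ 2) * Real.exp (-(δ * (geo9K i).dist y y')) * C := by
  have hΦ : ∀ (G : FBondY i → ℝ) (a : IBondY i), (geo9K i).suppIn (Sum.inr G) a →
      ∀ Ψ' : FBondY i → 𝔸, (∀ w, ‖Ψ' w‖ ≤ |G w|) → ‖(O.restrictScalars ℝ) Ψ' x‖
        ≤ B₀ * (geo9K i).len y ^ 2 * Real.exp (-(δ * (geo9K i).dist y a)) * (geo9K i).supNorm (Sum.inr G) :=
    fun G a hsa Ψ' hΨ' => h342₀ G y a hsa Ψ' hΨ' x hx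
  exact norm_apply_le_of_splitB i hδ ιB hι (O.restrictScalars ℝ) (by positivity) y y' x hΦ T hT hnbr Ψ hC hΨC hnear

end Readings

/-! ## §3 Windows and small factors: levels near `supp h_□`, level steps, the symmetrised insertion and its defect from `c_f` -/

section Small

omit [NormedRing 𝔸] [NormedAlgebra ℂ 𝔸] [CompleteSpace 𝔸] in
/-- **THE LOWER WINDOW NEAR `supp h_□`**: if `h_□(u) ≠ 0` and `|z − u|_T ≤ 1` then `j ≤ lev z + 1` (`Δ(z) ∈ QT □`, whose levels are `≥ j − 1`, [4] p. 235).
[cite: Balaban1984PropagatorsII, (2.2) p.224, p.235; Balaban1985BackgroundPropagators, (3.91) p.410] -/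
theorem le_levY_succ_of_near_hTY (c : ↥(cubes i.D.toDomains)) {z u : SiteY i} (hu : hTY i c u ≠ 0)
    (hzu : torusSupNorm (toKT i).NB (z.1 - u.1) ≤ 1) : c.1.1 ≤ levY i z + 1 := by
  have h := lvl_ge_of_mem_QT i c (mem_QT_and_lev_of_near i c hu hzu).1
  rwa [blkOf_fst_fst] at h

omit [NormedRing 𝔸] [NormedAlgebra ℂ 𝔸] [CompleteSpace 𝔸] in
/-- where a one-step difference of `h_□` does not vanish, `j ≤ lev z + 1` AND `lev z ≤ j + 1` (one of the two sites carries `h_□ ≠ 0`).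
[cite: Balaban1984PropagatorsII, (2.2) p.224, p.235; Balaban1985BackgroundPropagators, (3.100) p.413] -/
theorem window_of_sub_ne_zero (c : ↥(cubes i.D.toDomains)) {z u : SiteY i} (hzu : torusSupNorm (toKT i).NB (z.1 - u.1) ≤ 1)
    (hne : hTY i c u - hTY i c z ≠ 0) : c.1.1 ≤ levY i z + 1 ∧ levY i z ≤ c.1.1 + 1 := by
  by_cases hz : hTY i c z = 0
  · have hu : hTY i c u ≠ 0 := fun h0 => hne (by rw [h0, hz, sub_zero])
    exact ⟨le_levY_succ_of_near_hTY i c hu hzu, (mem_QT_and_lev_of_near i c hu hzu).2⟩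
  · exact ⟨le_levY_succ_of_near_hTY i c hz (torusSupNorm_sub_self_le_one i z),
      (mem_QT_and_lev_of_near i c hz (torusSupNorm_sub_self_le_one i z)).2⟩

omit [NormedRing 𝔸] [NormedAlgebra ℂ 𝔸] [CompleteSpace 𝔸] in
/-- **`n` LEVEL STEPS COST `L^{2n}`**: `lev ≤ lev′ + n ⇒ (L^{lev′})⁻² ≤ (Lⁿ)²·(L^{lev})⁻²`. [cite: Balaban1984PropagatorsII, (2.2) p.224, bookkeeping] -/
theorem inv_pow_sq_le_of_le_add {Lr : ℝ} (hL1 : 1 ≤ Lr) {lev lev' n : ℕ} (h : lev ≤ lev' + n) :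
    ((Lr ^ lev')⁻¹) ^ 2 ≤ (Lr ^ n) ^ 2 * ((Lr ^ lev)⁻¹) ^ 2 := by
  have hL0 : 0 < Lr := lt_of_lt_of_le one_pos hL1
  have h1 : Lr ^ lev ≤ Lr ^ lev' * Lr ^ n := by
    calc Lr ^ lev ≤ Lr ^ (lev' + n) := pow_le_pow_right₀ hL1 h
      _ = Lr ^ lev' * Lr ^ n := pow_add _ _ _
  have h2 : (Lr ^ lev')⁻¹ ≤ Lr ^ n * (Lr ^ lev)⁻¹ := by
    calc (Lr ^ lev')⁻¹ = (Lr ^ lev')⁻¹ * Lr ^ lev * (Lr ^ lev)⁻¹ := by rw [mul_assoc, mul_inv_cancel₀ (pow_ne_zero _ hL0.ne'), mul_one]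
      _ ≤ (Lr ^ lev')⁻¹ * (Lr ^ lev' * Lr ^ n) * (Lr ^ lev)⁻¹ :=
        mul_le_mul_of_nonneg_right (mul_le_mul_of_nonneg_left h1 (by positivity)) (by positivity)
      _ = Lr ^ n * (Lr ^ lev)⁻¹ := by rw [← mul_assoc, inv_mul_cancel₀ (pow_ne_zero _ hL0.ne'), one_mul]
  calc ((Lr ^ lev')⁻¹) ^ 2 ≤ (Lr ^ n * (Lr ^ lev)⁻¹) ^ 2 := pow_le_pow_left₀ (by positivity) h2 2
    _ = _ := by ring

omit [NormedRing 𝔸] [NormedAlgebra ℂ 𝔸] [CompleteSpace 𝔸] in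
/-- the unsquared form: `lev ≤ lev′ + n ⇒ (M^{lev′})⁻¹ ≤ Mⁿ·(M^{lev})⁻¹` (`M ≥ 1`). [cite: Balaban1984PropagatorsII, (2.2) p.224, bookkeeping] -/
theorem inv_pow_le_of_le_add {M : ℝ} (hM1 : 1 ≤ M) {lev lev' n : ℕ} (h : lev ≤ lev' + n) : (M ^ lev')⁻¹ ≤ M ^ n * (M ^ lev)⁻¹ := by
  have hM0 : 0 < M := lt_of_lt_of_le one_pos hM1
  have h1 : M ^ lev ≤ M ^ lev' * M ^ n := by
    calc M ^ lev ≤ M ^ (lev' + n) := pow_le_pow_right₀ hM1 h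
      _ = M ^ lev' * M ^ n := pow_add _ _ _
  calc (M ^ lev')⁻¹ = (M ^ lev')⁻¹ * M ^ lev * (M ^ lev)⁻¹ := by rw [mul_assoc, mul_inv_cancel₀ (pow_ne_zero _ hM0.ne'), mul_one]
    _ ≤ (M ^ lev')⁻¹ * (M ^ lev' * M ^ n) * (M ^ lev)⁻¹ :=
      mul_le_mul_of_nonneg_right (mul_le_mul_of_nonneg_left h1 (by positivity)) (by positivity)
    _ = M ^ n * (M ^ lev)⁻¹ := by rw [← mul_assoc, inv_mul_cancel₀ (pow_ne_zero _ hM0.ne'), one_mul]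

omit [NormedRing 𝔸] [NormedAlgebra ℂ 𝔸] [CompleteSpace 𝔸] in
/-- the box-chart shifts commute. [cite: Balaban1985BackgroundPropagators, (3.3) p.390, bookkeeping] -/
theorem shiftY_comm' (μ ν : Fin (d + 1)) (z : SiteY i) : shiftY i ν (shiftY i μ z) = shiftY i μ (shiftY i ν z) := by
  have h := shiftY_symm_shiftY_comm i μ ν (shiftY i μ z)
  rw [Equiv.symm_apply_apply, Equiv.symm_apply_eq] at h
  exact h

/-- **THE SYMMETRISED INSERTION IS BOUNDED BY `|c_f|ρ`**: `‖(jIns_{ae,z} + jIns_{ea,z})X‖ ≤ |c_f|ρ‖X‖` (at most one of the two is non-zero).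
[cite: Balaban1985BackgroundPropagators, (3.10) p.392, (3.7) p.391] -/
theorem norm_jsym_le (U : CfgY 𝔸 i) {ρ : ℝ} (hρ : 0 ≤ ρ) (hRe : ∀ p : PlaqY i, ‖reHolY i U p‖ ≤ ρ) (a e : Fin (d + 1)) (z : SiteY i) (X : 𝔸) :
    ‖(jIns i U a e z + jIns i U e a z) X‖ ≤ |i.cf| * ρ * ‖X‖ := by
  rw [LinearMap.add_apply]
  rcases lt_trichotomy a e with h | h | h
  · have h0 : jIns i U e a z = 0 := by unfold jIns; rw [dif_neg (lt_asymm h)]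
    rw [h0, LinearMap.zero_apply, add_zero]
    exact norm_jIns_le i U hρ hRe a e z X
  · subst h
    have h0 : jIns i U a a z = 0 := by unfold jIns; rw [dif_neg (lt_irrefl a)]
    rw [h0, LinearMap.zero_apply, add_zero, norm_zero]; positivity
  · have h0 : jIns i U a e z = 0 := by unfold jIns; rw [dif_neg (lt_asymm h)]
    rw [h0, LinearMap.zero_apply, zero_add]
    exact norm_jIns_le i U hρ hRe e a z X

/-- **THE DEFECT OF THE SYMMETRISED INSERTION FROM `c_f`** (`a ≠ e`): `‖(jIns_{ae,z} + jIns_{ea,z})X − c_f•X‖ ≤ |c_f|·B·‖X‖` whenever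
`‖Re U(∂p) − 1‖ ≤ B` at the plaquette at `chart⁻¹z` spanned by `a, e` («The operator Δ′ is small and local by (3.10)»: `𝒦 − 1` carries `Re U(∂p) − 1`).
[cite: Balaban1985BackgroundPropagators, (3.10) p.392, p.414 l.2–3, (3.69) p.404] -/
theorem norm_jsym_sub_le (U : CfgY 𝔸 i) {a e : Fin (d + 1)} (hae : a ≠ e) (z : SiteY i) (X : 𝔸) {B : ℝ}
    (hw : ∀ h : a < e, ‖reHolY i U ⟨(chartY i).symm z, a, e, h⟩ - 1‖ ≤ B)
    (hw' : ∀ h : e < a, ‖reHolY i U ⟨(chartY i).symm z, e, a, h⟩ - 1‖ ≤ B) :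
    ‖(jIns i U a e z + jIns i U e a z) X - ((i.cf : ℝ) : ℂ) • X‖ ≤ |i.cf| * B * ‖X‖ := by
  -- the Jordan map minus the identity is the Jordan map of `Re − 1`
  have key : ∀ (Xr : 𝔸), ‖Xr - 1‖ ≤ B →
      ‖(((i.cf : ℝ) : ℂ) • ((1 / 2 : ℂ) • (LinearMap.mulRight ℂ Xr + LinearMap.mulLeft ℂ Xr))) X - ((i.cf : ℝ) : ℂ) • X‖ ≤ |i.cf| * B * ‖X‖ := by
    intro Xr hXr
    have e1 : (((i.cf : ℝ) : ℂ) • ((1 / 2 : ℂ) • (LinearMap.mulRight ℂ Xr + LinearMap.mulLeft ℂ Xr))) X - ((i.cf : ℝ) : ℂ) • X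
        = ((i.cf : ℝ) : ℂ) • ((1 / 2 : ℂ) • (X * (Xr - 1) + (Xr - 1) * X)) := by
      simp only [LinearMap.smul_apply, LinearMap.add_apply, LinearMap.mulRight_apply, LinearMap.mulLeft_apply, mul_sub, sub_mul, mul_one, one_mul,
        smul_add, smul_sub]
      module
    rw [e1, norm_smul, norm_smul, Complex.norm_real, Real.norm_eq_abs]
    have hn : ‖(1 / 2 : ℂ)‖ = 1 / 2 := by norm_num
    rw [hn]
    have := norm_add_le (X * (Xr - 1)) ((Xr - 1) * X)
    have := norm_mul_le X (Xr - 1)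
    have := norm_mul_le (Xr - 1) X
    have : ‖X‖ * ‖Xr - 1‖ ≤ ‖X‖ * B := mul_le_mul_of_nonneg_left hXr (norm_nonneg _)
    have h0 : 0 ≤ |i.cf| := abs_nonneg _
    nlinarith [norm_nonneg X, norm_nonneg (Xr - 1)]
  rw [LinearMap.add_apply]
  rcases lt_trichotomy a e with h | h | h
  · have h0 : jIns i U e a z = 0 := by unfold jIns; rw [dif_neg (lt_asymm h)]
    rw [h0, LinearMap.zero_apply, add_zero]
    unfold jIns; rw [dif_pos h]
    exact key _ (hw h)
  · exact absurd h hae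
  · have h0 : jIns i U a e z = 0 := by unfold jIns; rw [dif_neg (lt_asymm h)]
    rw [h0, LinearMap.zero_apply, zero_add]
    unfold jIns; rw [dif_pos h]
    exact key _ (hw' h)

/-- the level-weighted plaquette datum passes to `Re U(∂p)` and to the chart: `‖Re U(∂p) − 1‖ ≤ δ̂·(L^{lev w})⁻²` at `p = (chart⁻¹w, a, e)`.
[cite: Balaban1985BackgroundPropagators, (3.69) p.404, (3.35) p.396, (3.7) p.391] -/
theorem norm_reHolY_sub_one_le_of_hW (U : CfgY 𝔸 i) (hU : ∀ μ x, ‖(U μ x : 𝔸)‖ ≤ 1 ∧ ‖(((U μ x)⁻¹ : 𝔸ˣ) : 𝔸)‖ ≤ 1) {δh : ℝ}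
    (hW : ∀ p : PlaqY i, ‖((holY i U p : 𝔸ˣ) : 𝔸) - 1‖ ≤ δh * ((((ℓ : ℝ) + 1) ^ levY i (chartY i p.src))⁻¹) ^ 2)
    (w : SiteY i) {a e : Fin (d + 1)} (h : a < e) :
    ‖reHolY i U ⟨(chartY i).symm w, a, e, h⟩ - 1‖ ≤ δh * ((((ℓ : ℝ) + 1) ^ levY i w)⁻¹) ^ 2 := by
  have h1 := hW ⟨(chartY i).symm w, a, e, h⟩
  have e1 : chartY i ((⟨(chartY i).symm w, a, e, h⟩ : PlaqY i).src) = w := Equiv.apply_symm_apply _ _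
  rw [e1] at h1
  exact (norm_reHolY_sub_one_le i U _ (bicontr_holY i U hU _)).trans h1

end Small

/-! ## §4 Sizes of the inputs of T1 at the cut-off of record `h_□` -/

section Sizes

variable (c : ↥(cubes i.D.toDomains)) (U : CfgY 𝔸 i) (Λ : FBondY i → 𝔸) (J : FBondY i → ℝ)
variable (hU : ∀ μ x, ‖(U μ x : 𝔸)‖ ≤ 1 ∧ ‖(((U μ x)⁻¹ : 𝔸ˣ) : 𝔸)‖ ≤ 1) (hΛ : ∀ x, ‖Λ x‖ ≤ |J x|)

/-- the `U`-transports are contractions on values: `‖R(U_μ z)X‖ ≤ ‖X‖`, `‖R(U_μ z)⁻¹X‖ ≤ ‖X‖`. [cite: Balaban1985BackgroundPropagators, (3.28) p.395, bookkeeping] -/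
theorem norm_R_UboxY_le (hU : ∀ μ x, ‖(U μ x : 𝔸)‖ ≤ 1 ∧ ‖(((U μ x)⁻¹ : 𝔸ˣ) : 𝔸)‖ ≤ 1) (μ : Fin (d + 1)) (z : SiteY i) (X : 𝔸) :
    ‖R (UboxY i U μ z) X‖ ≤ ‖X‖ ∧ ‖R (UboxY i U μ z)⁻¹ X‖ ≤ ‖X‖ := by
  have h := hU μ ((B6GlobalChartV1.boxEquiv i.hN).symm z)
  exact ⟨norm_R_le h.1 h.2 X, norm_R_le h.2 (by rw [inv_inv]; exact h.1) X⟩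

include hΛ in
omit [CompleteSpace 𝔸] in
/-- every component value of `Λ` is at most `|J|`. [cite: Balaban1985BackgroundPropagators, (3.39) p.397, bookkeeping] -/
theorem norm_bondCompY_le_supNorm (a : Fin (d + 1)) (z : SiteY i) : ‖bondCompY i a Λ z‖ ≤ (geo9K i).supNorm (Sum.inr J) := by
  rw [bondCompY_apply]; exact (hΛ _).trans (abs_le_supNorm_inr i J _)

include hU hΛ in
/-- the difference `D = ∇_μΛ_ν − ∇_νΛ_μ` at a site is at most `4|J|`. [cite: Balaban1985BackgroundPropagators, (3.4) p.391, (3.39) p.397] -/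
theorem norm_cdS_sub_cdS_le (μ ν : Fin (d + 1)) (w : SiteY i) :
    ‖cdS i U μ (bondCompY i ν Λ) w - cdS i U ν (bondCompY i μ Λ) w‖ ≤ 4 * (geo9K i).supNorm (Sum.inr J) := by
  have hc : ∀ (a e : Fin (d + 1)), ‖cdS i U a (bondCompY i e Λ) w‖ ≤ 2 * (geo9K i).supNorm (Sum.inr J) := fun a e => by
    rw [cdS_apply]
    refine (norm_sub_le _ _).trans ?_
    have t1 := (norm_R_le (hU a ((chartY i).symm w)).1 (hU a _).2 _).trans (norm_bondCompY_le_supNorm i Λ J hΛ e (shiftY i a w))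
    have t2 := norm_bondCompY_le_supNorm i Λ J hΛ e w
    linarith
  refine (norm_sub_le _ _).trans ?_
  linarith [hc μ ν, hc ν μ]

omit [NormedRing 𝔸] [NormedAlgebra ℂ 𝔸] [CompleteSpace 𝔸] in
/-- the backward difference of `h_□` per step: `|(∂⁻_μh_□)(z)| ≤ κ₁ = C1F∕(8S_j∕5)`. [cite: Balaban1984PropagatorsII, p.247 («|∂h_□| ≤ O(1)(MLʲη)⁻¹»)] -/
theorem abs_dg_hTY_le (μ : Fin (d + 1)) (z : SiteY i) : |dg i (hTY i c) μ z| ≤ C1F d ℓ / (8 / 5 * (bigSide ℓ i.Mh c.1.1 : ℝ)) := by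
  rw [dg_apply, abs_sub_comm]; exact abs_hTY_shiftY_symm_sub_le i c μ z

omit [NormedRing 𝔸] [NormedAlgebra ℂ 𝔸] [CompleteSpace 𝔸] in
/-- the same, one step ahead: `|(∂⁻_νh_□)(z + e_ν)| ≤ κ₁`. [cite: Balaban1984PropagatorsII, p.247] -/
theorem abs_dg_hTY_shiftY_le (ν : Fin (d + 1)) (z : SiteY i) : |dg i (hTY i c) ν (shiftY i ν z)| ≤ C1F d ℓ / (8 / 5 * (bigSide ℓ i.Mh c.1.1 : ℝ)) := by
  rw [dg_shiftY]; exact abs_hTY_shiftY_sub_le i c ν z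

omit [NormedRing 𝔸] [NormedAlgebra ℂ 𝔸] [CompleteSpace 𝔸] in
/-- the straight second difference: `|(∂⁻_μh_□)(z) − (∂⁻_μh_□)(z−e_μ)| ≤ κ₂ = C2F∕(8S_j∕5)²`. [cite: Balaban1984PropagatorsII, p.247 («|Δh_□| ≤ O(1)(MLʲη)⁻²»)] -/
theorem abs_dg_sub_dg_symm_le (μ : Fin (d + 1)) (z : SiteY i) :
    |dg i (hTY i c) μ z - dg i (hTY i c) μ ((shiftY i μ).symm z)| ≤ C2F d ℓ / (8 / 5 * (bigSide ℓ i.Mh c.1.1 : ℝ)) ^ 2 := by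
  have h := abs_hTY_second_diff_le i c μ ((shiftY i μ).symm z)
  rw [Equiv.apply_symm_apply] at h
  have e : dg i (hTY i c) μ z - dg i (hTY i c) μ ((shiftY i μ).symm z)
      = hTY i c z - 2 * hTY i c ((shiftY i μ).symm z) + hTY i c ((shiftY i μ).symm ((shiftY i μ).symm z)) := by
    rw [dg_apply, dg_apply]; ring
  rw [e]; exact h

omit [NormedRing 𝔸] [NormedAlgebra ℂ 𝔸] [CompleteSpace 𝔸] in
/-- the mixed second difference: `|(∂⁻_μh_□)(z+e_ν) − (∂⁻_μh_□)(z)| ≤ κ₂ₓ = C2X∕(8S_j∕5)²`. [cite: Balaban1984PropagatorsII, p.247; Balaban1985BackgroundPropagators, p.414 l.1–2] -/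
theorem abs_dg_shiftY_sub_dg_le (μ ν : Fin (d + 1)) (z : SiteY i) :
    |dg i (hTY i c) μ (shiftY i ν z) - dg i (hTY i c) μ z| ≤ C2X d ℓ / (8 / 5 * (bigSide ℓ i.Mh c.1.1 : ℝ)) ^ 2 := by
  have h := abs_hTY_mixed_le i c μ ν z
  have e : dg i (hTY i c) μ (shiftY i ν z) - dg i (hTY i c) μ z
      = -((hTY i c (shiftY i ν ((shiftY i μ).symm z)) - hTY i c (shiftY i ν z)) - (hTY i c ((shiftY i μ).symm z) - hTY i c z)) := by
    rw [dg_apply, dg_apply, shiftY_symm_shiftY_comm]; ring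
  rw [e, abs_neg]; exact h

/-! ### the five `∇*`-inputs -/

include hU hΛ in
/-- `‖dCurl_μ(b′)‖ ≤ 2|c_f|κ₁|J|` (insertion `≤ |c_f|` at bi-contractive plaquette variables, two edges of `κ₁|J|` each).
[cite: Balaban1985BackgroundPropagators, (3.10) p.392, (3.100) p.413; Balaban1984PropagatorsII, p.247] -/
theorem norm_dCurl_le (μ : Fin (d + 1)) (b : FBondY i) :
    ‖dCurl i (hTY i c) U Λ μ b‖ ≤ 2 * |i.cf| * (C1F d ℓ / (8 / 5 * (bigSide ℓ i.Mh c.1.1 : ℝ))) * (geo9K i).supNorm (Sum.inr J) := by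
  have hκ0 : 0 ≤ C1F d ℓ / (8 / 5 * (bigSide ℓ i.Mh c.1.1 : ℝ)) := div_nonneg (C1F_nonneg d ℓ) (by positivity)
  obtain ⟨x, hx⟩ : ∃ x, x = chartY i b.src := ⟨_, rfl⟩
  have hN : ‖curlCommComp i (hTY i c) U Λ μ b.dir x‖ ≤ 2 * (C1F d ℓ / (8 / 5 * (bigSide ℓ i.Mh c.1.1 : ℝ))) * (geo9K i).supNorm (Sum.inr J) := by
    unfold curlCommComp
    refine (norm_add_le _ _).trans ?_
    rw [norm_neg, norm_smul, norm_smul, Complex.norm_real, Complex.norm_real, Real.norm_eq_abs, Real.norm_eq_abs, fwdT_apply, fwdT_apply]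
    have t1 := mul_le_mul (abs_dg_hTY_shiftY_le i c μ x)
      ((norm_R_UboxY_le i U hU μ x (bondCompY i b.dir Λ (shiftY i μ x))).1.trans (norm_bondCompY_le_supNorm i Λ J hΛ b.dir (shiftY i μ x)))
      (norm_nonneg _) hκ0
    have t2 := mul_le_mul (abs_dg_hTY_shiftY_le i c b.dir x)
      ((norm_R_UboxY_le i U hU b.dir x (bondCompY i μ Λ (shiftY i b.dir x))).1.trans (norm_bondCompY_le_supNorm i Λ J hΛ μ (shiftY i b.dir x)))
      (norm_nonneg _) hκ0
    linarith
  unfold dCurl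
  rw [← hx]
  refine (norm_jsym_le i U zero_le_one (hRe_of_bicontractive i U hU) μ b.dir x _).trans ?_
  rw [mul_one]
  calc |i.cf| * ‖curlCommComp i (hTY i c) U Λ μ b.dir x‖
      ≤ |i.cf| * (2 * (C1F d ℓ / (8 / 5 * (bigSide ℓ i.Mh c.1.1 : ℝ))) * (geo9K i).supNorm (Sum.inr J)) := mul_le_mul_of_nonneg_left hN (abs_nonneg _)
    _ = _ := by ring

include hU hΛ in
/-- `‖dDiv(z)‖ ≤ |c_f|(d+1)κ₁|J|`. [cite: Balaban1985BackgroundPropagators, (3.8) p.392, (3.100) p.413; Balaban1984PropagatorsII, p.247] -/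
theorem norm_dDiv_le (z : SiteY i) :
    ‖dDiv i (hTY i c) U Λ z‖ ≤ |i.cf| * (((d : ℝ) + 1) * (C1F d ℓ / (8 / 5 * (bigSide ℓ i.Mh c.1.1 : ℝ))) * (geo9K i).supNorm (Sum.inr J)) := by
  have hκ0 : 0 ≤ C1F d ℓ / (8 / 5 * (bigSide ℓ i.Mh c.1.1 : ℝ)) := div_nonneg (C1F_nonneg d ℓ) (by positivity)
  unfold dDiv
  rw [norm_smul, Complex.norm_real, Real.norm_eq_abs]
  refine mul_le_mul_of_nonneg_left ?_ (abs_nonneg _)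
  calc ‖∑ a : Fin (d + 1), ((dg i (hTY i c) a z : ℝ) : ℂ) • bwdT i U a (bondCompY i a Λ) z‖
      ≤ ∑ a : Fin (d + 1), C1F d ℓ / (8 / 5 * (bigSide ℓ i.Mh c.1.1 : ℝ)) * (geo9K i).supNorm (Sum.inr J) := by
        refine (norm_sum_le _ _).trans (Finset.sum_le_sum fun a _ => ?_)
        rw [norm_smul, Complex.norm_real, Real.norm_eq_abs, bwdT_apply]
        exact mul_le_mul (abs_dg_hTY_le i c a z) ((norm_R_UboxY_le i U hU a _ (bondCompY i a Λ ((shiftY i a).symm z))).2.trans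
          (norm_bondCompY_le_supNorm i Λ J hΛ a _)) (norm_nonneg _) hκ0
    _ = _ := by rw [Finset.sum_const, Finset.card_univ, Fintype.card_fin, nsmul_eq_mul]; push_cast; ring

include hU in
/-- the embedding `J_μ` reads one transported neighbour value: `‖(J_μΦ)(b′)‖ ≤ ‖Φ(chart(b′₋) + e_μ)‖`. [cite: Balaban1985BackgroundPropagators, (3.3) p.390, (3.28) p.395] -/
theorem norm_Jb_le (μ : Fin (d + 1)) (Φ : SiteY i → 𝔸) (b : FBondY i) : ‖Jb i U μ Φ b‖ ≤ ‖Φ (shiftY i μ (chartY i b.src))‖ := by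
  rw [Jb_apply, shiftY_chartY]
  split_ifs
  · rw [norm_neg]; exact norm_R_le (hU μ _).1 (hU μ _).2 _
  · rw [norm_zero]; exact norm_nonneg _

include hΛ in
omit [CompleteSpace 𝔸] in
/-- `‖dMul_μ(b′)‖ ≤ |c_f|κ₁|J|`. [cite: Balaban1985BackgroundPropagators, (3.100) p.413; Balaban1984PropagatorsII, p.247] -/
theorem norm_dMul_le (μ : Fin (d + 1)) (b : FBondY i) :
    ‖dMul i (hTY i c) Λ μ b‖ ≤ |i.cf| * (C1F d ℓ / (8 / 5 * (bigSide ℓ i.Mh c.1.1 : ℝ))) * (geo9K i).supNorm (Sum.inr J) := by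
  have hκ0 : 0 ≤ C1F d ℓ / (8 / 5 * (bigSide ℓ i.Mh c.1.1 : ℝ)) := div_nonneg (C1F_nonneg d ℓ) (by positivity)
  unfold dMul
  rw [norm_neg, norm_smul, Complex.norm_real, Real.norm_eq_abs, cutMulY_apply, norm_smul, Complex.norm_real, Real.norm_eq_abs, hBdY_apply, mul_assoc]
  refine mul_le_mul_of_nonneg_left ?_ (abs_nonneg _)
  exact mul_le_mul (abs_dg_hTY_le i c μ _) ((hΛ b).trans (abs_le_supNorm_inr i J b)) (norm_nonneg _) hκ0

include hU hΛ in
/-- `‖dBwd_μ(z)‖ ≤ |c_f|κ₁|J|`. [cite: Balaban1985BackgroundPropagators, (3.8) p.392, (3.100) p.413; Balaban1984PropagatorsII, p.247] -/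
theorem norm_dBwd_le (μ : Fin (d + 1)) (z : SiteY i) :
    ‖dBwd i (hTY i c) U Λ μ z‖ ≤ |i.cf| * (C1F d ℓ / (8 / 5 * (bigSide ℓ i.Mh c.1.1 : ℝ))) * (geo9K i).supNorm (Sum.inr J) := by
  have hκ0 : 0 ≤ C1F d ℓ / (8 / 5 * (bigSide ℓ i.Mh c.1.1 : ℝ)) := div_nonneg (C1F_nonneg d ℓ) (by positivity)
  unfold dBwd
  rw [norm_neg, norm_smul, Complex.norm_real, Real.norm_eq_abs, norm_smul, Complex.norm_real, Real.norm_eq_abs, bwdT_apply, mul_assoc]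
  refine mul_le_mul_of_nonneg_left ?_ (abs_nonneg _)
  exact mul_le_mul (abs_dg_hTY_le i c μ _) ((norm_R_UboxY_le i U hU μ _ (bondCompY i μ Λ ((shiftY i μ).symm z))).2.trans
    (norm_bondCompY_le_supNorm i Λ J hΛ μ _)) (norm_nonneg _) hκ0

include hU hΛ in
/-- `‖dFwd_μ(b′)‖ ≤ |c_f|κ₁|J|`. [cite: Balaban1985BackgroundPropagators, (3.3) p.390, (3.100) p.413; Balaban1984PropagatorsII, p.247] -/
theorem norm_dFwd_le (μ : Fin (d + 1)) (b : FBondY i) :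
    ‖dFwd i (hTY i c) U Λ μ b‖ ≤ |i.cf| * (C1F d ℓ / (8 / 5 * (bigSide ℓ i.Mh c.1.1 : ℝ))) * (geo9K i).supNorm (Sum.inr J) := by
  have hκ0 : 0 ≤ C1F d ℓ / (8 / 5 * (bigSide ℓ i.Mh c.1.1 : ℝ)) := div_nonneg (C1F_nonneg d ℓ) (by positivity)
  unfold dFwd
  rw [norm_neg, norm_smul, Complex.norm_real, Real.norm_eq_abs, norm_smul, Complex.norm_real, Real.norm_eq_abs, fwdT_apply, mul_assoc]
  refine mul_le_mul_of_nonneg_left ?_ (abs_nonneg _)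
  exact mul_le_mul (abs_dg_hTY_shiftY_le i c b.dir (chartY i b.src)) ((norm_R_UboxY_le i U hU b.dir _
    (bondCompY i μ Λ (shiftY i b.dir (chartY i b.src)))).1.trans (norm_bondCompY_le_supNorm i Λ J hΛ μ _)) (norm_nonneg _) hκ0

/-! ### the six remainders -/

include hU hΛ in
/-- `‖zSec_μ(b′)‖ ≤ c_f²κ₂|J|` («O(M⁻²) on a proper scale»). [cite: Balaban1985BackgroundPropagators, p.414 l.1–2; Balaban1984PropagatorsII, p.247] -/
theorem norm_zSec_le (μ : Fin (d + 1)) (b : FBondY i) :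
    ‖zSec i (hTY i c) U Λ μ b‖ ≤ i.cf ^ 2 * (C2F d ℓ / (8 / 5 * (bigSide ℓ i.Mh c.1.1 : ℝ)) ^ 2 * (geo9K i).supNorm (Sum.inr J)) := by
  have hκ0 : 0 ≤ C2F d ℓ / (8 / 5 * (bigSide ℓ i.Mh c.1.1 : ℝ)) ^ 2 := div_nonneg (C2F_nonneg d ℓ) (by positivity)
  unfold zSec
  rw [norm_neg, norm_smul, norm_smul, Complex.norm_real, Complex.norm_real, Real.norm_eq_abs, Real.norm_eq_abs, abs_of_nonneg (sq_nonneg _)]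
  refine mul_le_mul_of_nonneg_left ?_ (sq_nonneg _)
  exact mul_le_mul (abs_dg_sub_dg_symm_le i c μ _) ((norm_R_UboxY_le i U hU μ _ _).2.trans (norm_bondCompY_le_supNorm i Λ J hΛ b.dir _))
    (norm_nonneg _) hκ0

include hU hΛ in
/-- `‖zMixB_μ(b′)‖ ≤ c_f²κ₂ₓ|J|`. [cite: Balaban1985BackgroundPropagators, p.414 l.1–2, (3.7) p.391; Balaban1984PropagatorsII, p.247] -/
theorem norm_zMixB_le (μ : Fin (d + 1)) (b : FBondY i) :
    ‖zMixB i (hTY i c) U Λ μ b‖ ≤ i.cf ^ 2 * (C2X d ℓ / (8 / 5 * (bigSide ℓ i.Mh c.1.1 : ℝ)) ^ 2 * (geo9K i).supNorm (Sum.inr J)) := by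
  have hκ0 : 0 ≤ C2X d ℓ / (8 / 5 * (bigSide ℓ i.Mh c.1.1 : ℝ)) ^ 2 := div_nonneg (C2X_bounds d ℓ).2.2 (by positivity)
  unfold zMixB
  rw [norm_smul, norm_smul, Complex.norm_real, Complex.norm_real, Real.norm_eq_abs, Real.norm_eq_abs, abs_of_nonneg (sq_nonneg _), fwdT_apply, bwdT_apply]
  refine mul_le_mul_of_nonneg_left ?_ (sq_nonneg _)
  exact mul_le_mul (abs_dg_shiftY_sub_dg_le i c μ b.dir _) (((norm_R_UboxY_le i U hU b.dir _ _).1.trans (norm_R_UboxY_le i U hU μ _ _).2).trans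
    (norm_bondCompY_le_supNorm i Λ J hΛ μ _)) (norm_nonneg _) hκ0

include hU hΛ in
/-- `‖zHolB_μ(b′)‖ ≤ c_f²κ₁·2δ̂(L^{lev w})⁻²·|J|`, `w = chart b′₋ − e_μ` (E′₅'s `δ_P` at the plaquette `p_{μν}(w)`).
[cite: Balaban1985BackgroundPropagators, (3.7) p.391, (3.69) p.404, (3.35) p.396] -/
theorem norm_zHolB_le {δh : ℝ} (hδh : 0 ≤ δh)
    (hW : ∀ p : PlaqY i, ‖((holY i U p : 𝔸ˣ) : 𝔸) - 1‖ ≤ δh * ((((ℓ : ℝ) + 1) ^ levY i (chartY i p.src))⁻¹) ^ 2) (μ : Fin (d + 1)) (b : FBondY i) :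
    ‖zHolB i (hTY i c) U Λ μ b‖ ≤ i.cf ^ 2 * (C1F d ℓ / (8 / 5 * (bigSide ℓ i.Mh c.1.1 : ℝ))
      * (2 * δh * ((((ℓ : ℝ) + 1) ^ levY i ((shiftY i μ).symm (chartY i b.src)))⁻¹) ^ 2 * (geo9K i).supNorm (Sum.inr J))) := by
  have hκ0 : 0 ≤ C1F d ℓ / (8 / 5 * (bigSide ℓ i.Mh c.1.1 : ℝ)) := div_nonneg (C1F_nonneg d ℓ) (by positivity)
  obtain ⟨w, hw⟩ : ∃ w, w = (shiftY i μ).symm (chartY i b.src) := ⟨_, rfl⟩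
  obtain ⟨Y, hY⟩ : ∃ Y : 𝔸, Y = R (UboxY i U b.dir w) (bondCompY i μ Λ (shiftY i b.dir w)) := ⟨_, rfl⟩
  have hYS : ‖Y‖ ≤ (geo9K i).supNorm (Sum.inr J) := by
    rw [hY]; exact (norm_R_UboxY_le i U hU b.dir w _).1.trans (norm_bondCompY_le_supNorm i Λ J hΛ μ _)
  have hP := hP_of_plaquettes i U hU hδh hW μ b.dir w Y
  unfold zHolB
  rw [← hw, ← hY, norm_neg, norm_smul, norm_smul, Complex.norm_real, Complex.norm_real, Real.norm_eq_abs, Real.norm_eq_abs, abs_of_nonneg (sq_nonneg _)]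
  refine mul_le_mul_of_nonneg_left ?_ (sq_nonneg _)
  refine mul_le_mul (abs_dg_hTY_le i c μ _) (((norm_R_UboxY_le i U hU μ w _).2.trans ?_)) (norm_nonneg _) hκ0
  rw [norm_sub_rev]
  refine hP.trans ?_
  have : 0 ≤ 2 * δh * ((((ℓ : ℝ) + 1) ^ levY i w)⁻¹) ^ 2 := by positivity
  exact mul_le_mul_of_nonneg_left hYS this

include hU hΛ in
/-- `‖zJor_μ(b′)‖ ≤ |c_f|κ₁·|c_f|δ̂(L^{lev w})⁻²·4|J|` (`μ = ν`: the term vanishes; `μ ≠ ν`: the defect `𝒦 − c_f` carries `Re U(∂p_{μν}(w)) − 1`).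
[cite: Balaban1985BackgroundPropagators, (3.10) p.392, p.414 l.2–3, (3.69) p.404] -/
theorem norm_zJor_le {δh : ℝ} (hδh : 0 ≤ δh)
    (hW : ∀ p : PlaqY i, ‖((holY i U p : 𝔸ˣ) : 𝔸) - 1‖ ≤ δh * ((((ℓ : ℝ) + 1) ^ levY i (chartY i p.src))⁻¹) ^ 2) (μ : Fin (d + 1)) (b : FBondY i) :
    ‖zJor i (hTY i c) U Λ μ b‖ ≤ |i.cf| * (C1F d ℓ / (8 / 5 * (bigSide ℓ i.Mh c.1.1 : ℝ))
      * (|i.cf| * (δh * ((((ℓ : ℝ) + 1) ^ levY i ((shiftY i μ).symm (chartY i b.src)))⁻¹) ^ 2) * (4 * (geo9K i).supNorm (Sum.inr J)))) := by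
  have hκ0 : 0 ≤ C1F d ℓ / (8 / 5 * (bigSide ℓ i.Mh c.1.1 : ℝ)) := div_nonneg (C1F_nonneg d ℓ) (by positivity)
  have hS0 : 0 ≤ (geo9K i).supNorm (Sum.inr J) := geo9K_supNorm_nonneg i _
  obtain ⟨w, hw⟩ : ∃ w, w = (shiftY i μ).symm (chartY i b.src) := ⟨_, rfl⟩
  obtain ⟨D, hD⟩ : ∃ D : 𝔸, D = cdS i U μ (bondCompY i b.dir Λ) w - cdS i U b.dir (bondCompY i μ Λ) w := ⟨_, rfl⟩
  have hD4 : ‖D‖ ≤ 4 * (geo9K i).supNorm (Sum.inr J) := by rw [hD]; exact norm_cdS_sub_cdS_le i U Λ J hU hΛ μ b.dir w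
  unfold zJor
  rw [← hw, ← hD, norm_smul, norm_smul, Complex.norm_real, Complex.norm_real, Real.norm_eq_abs, Real.norm_eq_abs]
  refine mul_le_mul_of_nonneg_left ?_ (abs_nonneg _)
  refine mul_le_mul (abs_dg_hTY_le i c μ _) (((norm_R_UboxY_le i U hU μ w _).2.trans ?_)) (norm_nonneg _) hκ0
  by_cases hμν : μ = b.dir
  · have hD0 : D = 0 := by rw [hD, hμν, sub_self]
    rw [hD0, map_zero, smul_zero, sub_self, norm_zero]; positivity
  · refine (norm_jsym_sub_le i U hμν w D (fun h => norm_reHolY_sub_one_le_of_hW i U hU hW w h)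
      (fun h => norm_reHolY_sub_one_le_of_hW i U hU hW w h)).trans ?_
    have : 0 ≤ |i.cf| * (δh * ((((ℓ : ℝ) + 1) ^ levY i w)⁻¹) ^ 2) := by positivity
    exact mul_le_mul_of_nonneg_left hD4 this

include hU hΛ in
/-- `‖zMixF_μ(b′)‖ ≤ c_f²κ₂ₓ|J|`. [cite: Balaban1985BackgroundPropagators, p.414 l.1–2, (3.7) p.391; Balaban1984PropagatorsII, p.247] -/
theorem norm_zMixF_le (μ : Fin (d + 1)) (b : FBondY i) :
    ‖zMixF i (hTY i c) U Λ μ b‖ ≤ i.cf ^ 2 * (C2X d ℓ / (8 / 5 * (bigSide ℓ i.Mh c.1.1 : ℝ)) ^ 2 * (geo9K i).supNorm (Sum.inr J)) := by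
  have hκ0 : 0 ≤ C2X d ℓ / (8 / 5 * (bigSide ℓ i.Mh c.1.1 : ℝ)) ^ 2 := div_nonneg (C2X_bounds d ℓ).2.2 (by positivity)
  obtain ⟨w, hw⟩ : ∃ w, w = (shiftY i μ).symm (chartY i b.src) := ⟨_, rfl⟩
  have hx : chartY i b.src = shiftY i μ w := by rw [hw, shiftY_shiftY_symm]
  have hmix : |dg i (hTY i c) b.dir (shiftY i b.dir (chartY i b.src)) - dg i (hTY i c) b.dir (shiftY i b.dir w)|
      ≤ C2X d ℓ / (8 / 5 * (bigSide ℓ i.Mh c.1.1 : ℝ)) ^ 2 := by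
    rw [hx, shiftY_comm' i μ b.dir w]
    exact abs_dg_shiftY_sub_dg_le i c b.dir μ (shiftY i b.dir w)
  unfold zMixF
  rw [← hw, norm_neg, norm_smul, norm_smul, Complex.norm_real, Complex.norm_real, Real.norm_eq_abs, Real.norm_eq_abs, abs_of_nonneg (sq_nonneg _),
    fwdT_apply]
  refine mul_le_mul_of_nonneg_left ?_ (sq_nonneg _)
  exact mul_le_mul hmix (((norm_R_UboxY_le i U hU μ w _).2.trans (norm_R_UboxY_le i U hU b.dir w _).1).trans
    (norm_bondCompY_le_supNorm i Λ J hΛ μ _)) (norm_nonneg _) hκ0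

include hU hΛ in
/-- `‖zHolF_μ(b′)‖ ≤ c_f²κ₁·2δ̂(L^{lev w})⁻²·|J|`. [cite: Balaban1985BackgroundPropagators, (3.7) p.391, (3.69) p.404, (3.35) p.396] -/
theorem norm_zHolF_le {δh : ℝ} (hδh : 0 ≤ δh)
    (hW : ∀ p : PlaqY i, ‖((holY i U p : 𝔸ˣ) : 𝔸) - 1‖ ≤ δh * ((((ℓ : ℝ) + 1) ^ levY i (chartY i p.src))⁻¹) ^ 2) (μ : Fin (d + 1)) (b : FBondY i) :
    ‖zHolF i (hTY i c) U Λ μ b‖ ≤ i.cf ^ 2 * (C1F d ℓ / (8 / 5 * (bigSide ℓ i.Mh c.1.1 : ℝ))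
      * (2 * δh * ((((ℓ : ℝ) + 1) ^ levY i ((shiftY i μ).symm (chartY i b.src)))⁻¹) ^ 2 * (geo9K i).supNorm (Sum.inr J))) := by
  have hκ0 : 0 ≤ C1F d ℓ / (8 / 5 * (bigSide ℓ i.Mh c.1.1 : ℝ)) := div_nonneg (C1F_nonneg d ℓ) (by positivity)
  obtain ⟨w, hw⟩ : ∃ w, w = (shiftY i μ).symm (chartY i b.src) := ⟨_, rfl⟩
  obtain ⟨Y, hY⟩ : ∃ Y : 𝔸, Y = R (UboxY i U b.dir w) (bondCompY i μ Λ (shiftY i b.dir w)) := ⟨_, rfl⟩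
  have hYS : ‖Y‖ ≤ (geo9K i).supNorm (Sum.inr J) := by
    rw [hY]; exact (norm_R_UboxY_le i U hU b.dir w _).1.trans (norm_bondCompY_le_supNorm i Λ J hΛ μ _)
  have hP := hP_of_plaquettes i U hU hδh hW μ b.dir w Y
  unfold zHolF
  rw [← hw, ← hY, norm_neg, norm_smul, norm_smul, Complex.norm_real, Complex.norm_real, Real.norm_eq_abs, Real.norm_eq_abs, abs_of_nonneg (sq_nonneg _)]
  refine mul_le_mul_of_nonneg_left ?_ (sq_nonneg _)
  refine mul_le_mul (abs_dg_hTY_shiftY_le i c b.dir _) (((norm_R_UboxY_le i U hU μ w _).2.trans ?_)) (norm_nonneg _) hκ0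
  refine hP.trans ?_
  have : 0 ≤ 2 * δh * ((((ℓ : ℝ) + 1) ^ levY i w)⁻¹) ^ 2 := by positivity
  exact mul_le_mul_of_nonneg_left hYS this

/-! ### the windows of the three remainders that carry a plaquette factor -/

omit [NormedAlgebra ℂ 𝔸] [CompleteSpace 𝔸] in
/-- `zHolB_μ(b′) ≠ 0 ⇒ (∂⁻_μh_□)(x) ≠ 0 ⇒ j ≤ lev w + 2`, `w = x − e_μ`. [cite: Balaban1984PropagatorsII, (2.2) p.224, p.235] -/
theorem window_of_dg_ne_zero (μ : Fin (d + 1)) (x : SiteY i) (hne : dg i (hTY i c) μ x ≠ 0) :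
    c.1.1 ≤ levY i ((shiftY i μ).symm x) + 2 ∧ levY i x ≤ c.1.1 + 1 := by
  have hwx : torusSupNorm (toKT i).NB (((shiftY i μ).symm x).1 - x.1) ≤ 1 := touch_symm i (torusSupNorm_sub_shiftY_le_one i μ x).2
  rw [dg_apply] at hne
  have hne' : hTY i c ((shiftY i μ).symm x) - hTY i c x ≠ 0 := fun h0 => hne (by rw [sub_eq_zero] at h0 ⊢; exact h0.symm)
  have h1 := window_of_sub_ne_zero i c hwx hne
  have h2 := window_of_sub_ne_zero i c (torusSupNorm_sub_shiftY_le_one i μ x).2 hne'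
  exact ⟨by omega, h2.2⟩

omit [NormedAlgebra ℂ 𝔸] [CompleteSpace 𝔸] in
/-- `(∂⁻_νh_□)(x + e_ν) ≠ 0 ⇒ j ≤ lev(x − e_μ) + 2`. [cite: Balaban1984PropagatorsII, (2.2) p.224, p.235] -/
theorem window_of_dg_shiftY_ne_zero (μ ν : Fin (d + 1)) (x : SiteY i) (hne : dg i (hTY i c) ν (shiftY i ν x) ≠ 0) :
    c.1.1 ≤ levY i ((shiftY i μ).symm x) + 2 ∧ levY i x ≤ c.1.1 + 1 := by
  rw [dg_shiftY] at hne
  have h1 := window_of_sub_ne_zero i c (torusSupNorm_sub_shiftY_le_one i ν x).1 hne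
  have h2 := lev_le_succ_of_touch' i (torusSupNorm_sub_shiftY_le_one i μ x).2
  exact ⟨by omega, h1.2⟩

end Sizes

/-! ## §5 Supports of the inputs of T1: two lattice steps off `supp Λ ⊂ Δ(βy′)` -/

section Supports

variable (U : CfgY 𝔸 i) (Λ : FBondY i → 𝔸) (J : FBondY i → ℝ) (hΛ : ∀ x, ‖Λ x‖ ≤ |J x|)
variable (ιB : BlkY i → IBondY i) (hι : ∀ s, β i.hN i.D i.hk (ιB s) = s) {y' : IBondY i} (hs : (geo9K i).suppIn (Sum.inr J) y')

omit [NormedAlgebra ℂ 𝔸] [CompleteSpace 𝔸] in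
/-- `R(W)X ≠ 0 ⇒ X ≠ 0`. [folklore] -/
private theorem ne_zero_of_R_ne_zero {W : 𝔸ˣ} {X : 𝔸} (h : R W X ≠ 0) : X ≠ 0 := fun h0 => h (by rw [h0, R_zero])

omit [CompleteSpace 𝔸] in
/-- `c•X ≠ 0 ⇒ X ≠ 0`. [folklore] -/
private theorem ne_zero_of_smul_ne_zero' {a : ℂ} {X : 𝔸} (h : a • X ≠ 0) : X ≠ 0 := fun h0 => h (smul_eq_zero_of_right a h0)

include hΛ in
omit [CompleteSpace 𝔸] in
/-- a non-zero component value exposes `J ≠ 0` at that bond. [cite: Balaban1985BackgroundPropagators, (3.39) p.397, bookkeeping] -/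
theorem J_ne_zero_of_bondCompY_ne_zero {a : Fin (d + 1)} {z : SiteY i} (h : bondCompY i a Λ z ≠ 0) : J ⟨(chartY i).symm z, a⟩ ≠ 0 := by
  rw [bondCompY_apply] at h
  exact fun h0 => h (norm_le_zero_iff.1 ((hΛ _).trans (by rw [h0, abs_zero])))

include hΛ hι hs in
omit [CompleteSpace 𝔸] in
/-- **TWO LATTICE STEPS IN BLOCKS**: a non-zero component `Λ_a(u)` at a site `u` whose block is within `2` of the block of `x` puts `ιBΔ(x)` within `2` of `y′`.
[cite: Balaban1984PropagatorsII, (2.2) p.224, (2.46) p.231, (2.51) p.232] -/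
theorem near_of_bondCompY_ne_zero {x u : SiteY i} {a : Fin (d + 1)}
    (hd2 : ((bondT i.D).dist (blkOf i.D.toDomains x) (blkOf i.D.toDomains u) : ℝ) ≤ 2) (hne : bondCompY i a Λ u ≠ 0) :
    (geo9K i).dist (ιB (blkOf i.D.toDomains x)) y' ≤ 2 := by
  have hJ := J_ne_zero_of_bondCompY_ne_zero i Λ J hΛ hne
  have hblk : blkV1 i.hN i.D (⟨(chartY i).symm u, a⟩ : FBondY i) = β i.hN i.D i.hk y' := hs _ hJ
  have hb' : blkV1 i.hN i.D (⟨(chartY i).symm u, a⟩ : FBondY i) = blkOf i.D.toDomains u := by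
    show blkOf i.D.toDomains (chartY i ((chartY i).symm u)) = _
    rw [Equiv.apply_symm_apply]
  rw [geo9K_dist_eq, hι, ← hblk, hb']
  exact hd2

omit [NormedAlgebra ℂ 𝔸] [CompleteSpace 𝔸] in
/-- zero, one and two steps are within block distance `2`. [cite: Balaban1984PropagatorsII, (2.46) p.231, bookkeeping] -/
theorem bd2_self (x : SiteY i) : ((bondT i.D).dist (blkOf i.D.toDomains x) (blkOf i.D.toDomains x) : ℝ) ≤ 2 := by
  rw [SimpleGraph.dist_self]; norm_num

omit [NormedAlgebra ℂ 𝔸] [CompleteSpace 𝔸] in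
/-- one step. [cite: Balaban1984PropagatorsII, (2.46) p.231, bookkeeping] -/
theorem bd2_step {x u : SiteY i} (h : torusSupNorm (toKT i).NB (x.1 - u.1) ≤ 1) :
    ((bondT i.D).dist (blkOf i.D.toDomains x) (blkOf i.D.toDomains u) : ℝ) ≤ 2 :=
  (step_facts i h).1.trans one_le_two

omit [NormedAlgebra ℂ 𝔸] [CompleteSpace 𝔸] in
/-- two steps. [cite: Balaban1984PropagatorsII, (2.46) p.231, bookkeeping] -/
theorem bd2_two {x u₁ u : SiteY i} (h₁ : torusSupNorm (toKT i).NB (x.1 - u₁.1) ≤ 1) (h₂ : torusSupNorm (toKT i).NB (u₁.1 - u.1) ≤ 1) :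
    ((bondT i.D).dist (blkOf i.D.toDomains x) (blkOf i.D.toDomains u) : ℝ) ≤ 2 :=
  (two_step_facts i h₁ h₂).1

include hΛ hι hs in
/-- `dCurl_μ(b′) ≠ 0 ⇒ d(ιBΔ(b′), y′) ≤ 2`. [cite: Balaban1985BackgroundPropagators, (3.100) p.413; Balaban1984PropagatorsII, (2.51) p.232] -/
theorem near_dCurl (h : SiteY i → ℝ) (μ : Fin (d + 1)) {b : FBondY i} (hne : dCurl i h U Λ μ b ≠ 0) :
    (geo9K i).dist (ιB (blkV1 i.hN i.D b)) y' ≤ 2 := by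
  have hcc : curlCommComp i h U Λ μ b.dir (chartY i b.src) ≠ 0 := fun h0 => hne (by unfold dCurl; rw [h0, map_zero])
  by_cases h1 : fwdT i U μ (bondCompY i b.dir Λ) (chartY i b.src) = 0
  · have h2 : fwdT i U b.dir (bondCompY i μ Λ) (chartY i b.src) ≠ 0 := fun h2 =>
      hcc (by unfold curlCommComp; rw [h1, h2, smul_zero, smul_zero, neg_zero, add_zero])
    rw [fwdT_apply] at h2
    exact near_of_bondCompY_ne_zero i Λ J hΛ ιB hι hs (bd2_step i (torusSupNorm_sub_shiftY_le_one i b.dir _).1) (ne_zero_of_R_ne_zero h2)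
  · rw [fwdT_apply] at h1
    exact near_of_bondCompY_ne_zero i Λ J hΛ ιB hι hs (bd2_step i (torusSupNorm_sub_shiftY_le_one i μ _).1) (ne_zero_of_R_ne_zero h1)

include hΛ hι hs in
/-- `(J_μ dDiv)(b′) ≠ 0 ⇒ d(ιBΔ(b′), y′) ≤ 2`. [cite: Balaban1985BackgroundPropagators, (3.100) p.413, (3.8) p.392; Balaban1984PropagatorsII, (2.51) p.232] -/
theorem near_Jb_dDiv (h : SiteY i → ℝ) (μ : Fin (d + 1)) {b : FBondY i} (hne : Jb i U μ (dDiv i h U Λ) b ≠ 0) :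
    (geo9K i).dist (ιB (blkV1 i.hN i.D b)) y' ≤ 2 := by
  rw [Jb_apply] at hne
  split_ifs at hne with hdir
  · rw [← shiftY_chartY] at hne
    have h1 : dDiv i h U Λ (shiftY i μ (chartY i b.src)) ≠ 0 := ne_zero_of_R_ne_zero (neg_ne_zero.1 hne)
    unfold dDiv at h1
    obtain ⟨a, -, ha⟩ := Finset.exists_ne_zero_of_sum_ne_zero (ne_zero_of_smul_ne_zero' h1)
    rw [bwdT_apply] at ha
    exact near_of_bondCompY_ne_zero i Λ J hΛ ιB hι hs
      (bd2_two i (torusSupNorm_sub_shiftY_le_one i μ _).1 (torusSupNorm_sub_shiftY_le_one i a _).2) (ne_zero_of_R_ne_zero (ne_zero_of_smul_ne_zero' ha))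
  · exact absurd rfl hne

include hΛ hι hs in
omit [CompleteSpace 𝔸] in
/-- `dMul_μ(b′) ≠ 0 ⇒ Λ(b′) ≠ 0 ⇒ d(ιBΔ(b′), y′) = 0`. [cite: Balaban1985BackgroundPropagators, (3.100) p.413; Balaban1984PropagatorsII, (2.51) p.232] -/
theorem near_dMul (h : SiteY i → ℝ) (μ : Fin (d + 1)) {b : FBondY i} (hne : dMul i h Λ μ b ≠ 0) :
    (geo9K i).dist (ιB (blkV1 i.hN i.D b)) y' ≤ 2 := by
  have h1 : Λ b ≠ 0 := by
    intro h0; apply hne; unfold dMul; rw [cutMulY_apply, h0, smul_zero, smul_zero, neg_zero]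
  have hJ : J b ≠ 0 := fun h0 => h1 (norm_le_zero_iff.1 ((hΛ _).trans (by rw [h0, abs_zero])))
  rw [geo9K_dist_eq, hι, hs b hJ, SimpleGraph.dist_self]; norm_num

include hΛ hι hs in
/-- `(J_λ dBwd_μ)(b′) ≠ 0 ⇒ d(ιBΔ(b′), y′) ≤ 2`. [cite: Balaban1985BackgroundPropagators, (3.8) p.392, (3.100) p.413; Balaban1984PropagatorsII, (2.51) p.232] -/
theorem near_Jb_dBwd (h : SiteY i → ℝ) (μ lam : Fin (d + 1)) {b : FBondY i} (hne : Jb i U lam (dBwd i h U Λ μ) b ≠ 0) :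
    (geo9K i).dist (ιB (blkV1 i.hN i.D b)) y' ≤ 2 := by
  rw [Jb_apply] at hne
  split_ifs at hne with hdir
  · rw [← shiftY_chartY] at hne
    have h1 : dBwd i h U Λ μ (shiftY i lam (chartY i b.src)) ≠ 0 := ne_zero_of_R_ne_zero (neg_ne_zero.1 hne)
    unfold dBwd at h1
    have h2 := ne_zero_of_smul_ne_zero' (ne_zero_of_smul_ne_zero' (neg_ne_zero.1 h1))
    rw [bwdT_apply] at h2
    exact near_of_bondCompY_ne_zero i Λ J hΛ ιB hι hs
      (bd2_two i (torusSupNorm_sub_shiftY_le_one i lam _).1 (torusSupNorm_sub_shiftY_le_one i μ _).2) (ne_zero_of_R_ne_zero h2)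
  · exact absurd rfl hne

include hΛ hι hs in
/-- `dFwd_μ(b′) ≠ 0 ⇒ d(ιBΔ(b′), y′) ≤ 2`. [cite: Balaban1985BackgroundPropagators, (3.3) p.390, (3.100) p.413; Balaban1984PropagatorsII, (2.51) p.232] -/
theorem near_dFwd (h : SiteY i → ℝ) (μ : Fin (d + 1)) {b : FBondY i} (hne : dFwd i h U Λ μ b ≠ 0) :
    (geo9K i).dist (ιB (blkV1 i.hN i.D b)) y' ≤ 2 := by
  unfold dFwd at hne
  have h2 := ne_zero_of_smul_ne_zero' (ne_zero_of_smul_ne_zero' (neg_ne_zero.1 hne))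
  rw [fwdT_apply] at h2
  exact near_of_bondCompY_ne_zero i Λ J hΛ ιB hι hs (bd2_step i (torusSupNorm_sub_shiftY_le_one i b.dir _).1) (ne_zero_of_R_ne_zero h2)

include hΛ hι hs in
/-- `zSec_μ(b′) ≠ 0 ⇒ d ≤ 2`. [cite: Balaban1985BackgroundPropagators, p.414 l.1–2; Balaban1984PropagatorsII, (2.51) p.232] -/
theorem near_zSec (h : SiteY i → ℝ) (μ : Fin (d + 1)) {b : FBondY i} (hne : zSec i h U Λ μ b ≠ 0) :
    (geo9K i).dist (ιB (blkV1 i.hN i.D b)) y' ≤ 2 := by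
  unfold zSec at hne
  have h2 := ne_zero_of_R_ne_zero (ne_zero_of_smul_ne_zero' (ne_zero_of_smul_ne_zero' (neg_ne_zero.1 hne)))
  exact near_of_bondCompY_ne_zero i Λ J hΛ ιB hι hs (bd2_step i (torusSupNorm_sub_shiftY_le_one i μ _).2) h2

include hΛ hι hs in
/-- `zMixB_μ(b′) ≠ 0 ⇒ d ≤ 2`. [cite: Balaban1985BackgroundPropagators, p.414 l.1–2; Balaban1984PropagatorsII, (2.51) p.232] -/
theorem near_zMixB (h : SiteY i → ℝ) (μ : Fin (d + 1)) {b : FBondY i} (hne : zMixB i h U Λ μ b ≠ 0) :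
    (geo9K i).dist (ιB (blkV1 i.hN i.D b)) y' ≤ 2 := by
  unfold zMixB at hne
  have h2 := ne_zero_of_smul_ne_zero' (ne_zero_of_smul_ne_zero' hne)
  rw [fwdT_apply, bwdT_apply] at h2
  exact near_of_bondCompY_ne_zero i Λ J hΛ ιB hι hs
    (bd2_two i (torusSupNorm_sub_shiftY_le_one i b.dir _).1 (torusSupNorm_sub_shiftY_le_one i μ _).2) (ne_zero_of_R_ne_zero (ne_zero_of_R_ne_zero h2))

include hΛ hι hs in
/-- `zHolB_μ(b′) ≠ 0 ⇒ d ≤ 2`. [cite: Balaban1985BackgroundPropagators, (3.7) p.391; Balaban1984PropagatorsII, (2.51) p.232] -/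
theorem near_zHolB (h : SiteY i → ℝ) (μ : Fin (d + 1)) {b : FBondY i} (hne : zHolB i h U Λ μ b ≠ 0) :
    (geo9K i).dist (ιB (blkV1 i.hN i.D b)) y' ≤ 2 := by
  unfold zHolB at hne
  have h2 := ne_zero_of_R_ne_zero (ne_zero_of_smul_ne_zero' (ne_zero_of_smul_ne_zero' (neg_ne_zero.1 hne)))
  have h3 : R (UboxY i U b.dir ((shiftY i μ).symm (chartY i b.src))) (bondCompY i μ Λ (shiftY i b.dir ((shiftY i μ).symm (chartY i b.src)))) ≠ 0 := by
    intro h0; apply h2; rw [h0, R_zero, sub_zero]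
  exact near_of_bondCompY_ne_zero i Λ J hΛ ιB hι hs
    (bd2_two i (torusSupNorm_sub_shiftY_le_one i μ _).2 (torusSupNorm_sub_shiftY_le_one i b.dir _).1) (ne_zero_of_R_ne_zero h3)

include hΛ hι hs in
/-- `zJor_μ(b′) ≠ 0 ⇒ d ≤ 2` (the difference `∇_μΛ_ν − ∇_νΛ_μ` at `w` reads `Λ` at `w`, `w + e_μ`, `w + e_ν`).
[cite: Balaban1985BackgroundPropagators, (3.10) p.392, (3.4) p.391; Balaban1984PropagatorsII, (2.51) p.232] -/
theorem near_zJor (h : SiteY i → ℝ) (μ : Fin (d + 1)) {b : FBondY i} (hne : zJor i h U Λ μ b ≠ 0) :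
    (geo9K i).dist (ιB (blkV1 i.hN i.D b)) y' ≤ 2 := by
  obtain ⟨w, hw⟩ : ∃ w, w = (shiftY i μ).symm (chartY i b.src) := ⟨_, rfl⟩
  have hxw : torusSupNorm (toKT i).NB ((chartY i b.src).1 - w.1) ≤ 1 := by rw [hw]; exact (torusSupNorm_sub_shiftY_le_one i μ _).2
  unfold zJor at hne
  rw [← hw] at hne
  have h2 := ne_zero_of_R_ne_zero (ne_zero_of_smul_ne_zero' (ne_zero_of_smul_ne_zero' hne))
  have hD : cdS i U μ (bondCompY i b.dir Λ) w - cdS i U b.dir (bondCompY i μ Λ) w ≠ 0 := by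
    intro h0; apply h2; rw [h0, map_zero, smul_zero, sub_self]
  rw [cdS_apply, cdS_apply] at hD
  by_cases h1 : bondCompY i b.dir Λ (shiftY i μ w) ≠ 0
  · exact near_of_bondCompY_ne_zero i Λ J hΛ ιB hι hs (bd2_two i hxw (torusSupNorm_sub_shiftY_le_one i μ w).1) h1
  by_cases h2' : bondCompY i b.dir Λ w ≠ 0
  · exact near_of_bondCompY_ne_zero i Λ J hΛ ιB hι hs (bd2_step i hxw) h2'
  by_cases h3 : bondCompY i μ Λ (shiftY i b.dir w) ≠ 0
  · exact near_of_bondCompY_ne_zero i Λ J hΛ ιB hι hs (bd2_two i hxw (torusSupNorm_sub_shiftY_le_one i b.dir w).1) h3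
  by_cases h4 : bondCompY i μ Λ w ≠ 0
  · exact near_of_bondCompY_ne_zero i Λ J hΛ ιB hι hs (bd2_step i hxw) h4
  push Not at h1 h2' h3 h4
  exact (hD (by simp only [h1, h2', h3, h4, R_zero, sub_self])).elim

include hΛ hι hs in
/-- `zMixF_μ(b′) ≠ 0 ⇒ d ≤ 2`. [cite: Balaban1985BackgroundPropagators, p.414 l.1–2; Balaban1984PropagatorsII, (2.51) p.232] -/
theorem near_zMixF (h : SiteY i → ℝ) (μ : Fin (d + 1)) {b : FBondY i} (hne : zMixF i h U Λ μ b ≠ 0) :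
    (geo9K i).dist (ιB (blkV1 i.hN i.D b)) y' ≤ 2 := by
  unfold zMixF at hne
  have h2 := ne_zero_of_R_ne_zero (ne_zero_of_smul_ne_zero' (ne_zero_of_smul_ne_zero' (neg_ne_zero.1 hne)))
  rw [fwdT_apply] at h2
  exact near_of_bondCompY_ne_zero i Λ J hΛ ιB hι hs
    (bd2_two i (torusSupNorm_sub_shiftY_le_one i μ _).2 (torusSupNorm_sub_shiftY_le_one i b.dir _).1) (ne_zero_of_R_ne_zero h2)

include hΛ hι hs in
/-- `zHolF_μ(b′) ≠ 0 ⇒ d ≤ 2`. [cite: Balaban1985BackgroundPropagators, (3.7) p.391; Balaban1984PropagatorsII, (2.51) p.232] -/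
theorem near_zHolF (h : SiteY i → ℝ) (μ : Fin (d + 1)) {b : FBondY i} (hne : zHolF i h U Λ μ b ≠ 0) :
    (geo9K i).dist (ιB (blkV1 i.hN i.D b)) y' ≤ 2 := by
  unfold zHolF at hne
  have h2 := ne_zero_of_R_ne_zero (ne_zero_of_smul_ne_zero' (ne_zero_of_smul_ne_zero' (neg_ne_zero.1 hne)))
  have h3 : R (UboxY i U b.dir ((shiftY i μ).symm (chartY i b.src))) (bondCompY i μ Λ (shiftY i b.dir ((shiftY i μ).symm (chartY i b.src)))) ≠ 0 := by
    intro h0; apply h2; rw [h0, R_zero, sub_zero]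
  exact near_of_bondCompY_ne_zero i Λ J hΛ ιB hι hs
    (bd2_two i (torusSupNorm_sub_shiftY_le_one i μ _).2 (torusSupNorm_sub_shiftY_le_one i b.dir _).1) (ne_zero_of_R_ne_zero h3)

/-! ### `[h,Δ′₂]Λ` and `[h,Q*aQ]Λ`: supports and windows -/

/-- **`[h,Q*aQ]Λ(b′)` VANISHES UNLESS `Λ ≠ 0` ON A FINE BOND AVERAGED BY A COARSE BOND AVERAGING `b′`.**
[cite: Balaban1985BackgroundPropagators, (3.102)–(3.103) p.414, (3.13) p.393] -/
theorem avg_apply_eq_zero_of (h : SiteY i → ℝ) (parB : BondParY 𝔸 i) (U : CfgY 𝔸 i) (A : FBondY i → 𝔸) (b : FBondY i)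
    (hA : ∀ (y : IBondY i) (f : FBondY i), qsK i b y ≠ 0 → qK i y f ≠ 0 → A f = 0) :
    cutCommR (hBdY i h) (hBdY i h) (QsY i parB U ∘ₗ aY i ∘ₗ QY i parB U) A b = 0 := by
  have hQ : ∀ y : IBondY i, qsK i b y ≠ 0 → QY i parB U A y = 0 := fun y hy =>
    trLiftY_apply_eq_zero_of (qK i) (qT i parB U) A y fun f hf => hA y f hy hf
  rw [cutCommR_QsY_aY_QY, LinearMap.add_apply, Pi.add_apply, LinearMap.comp_apply, LinearMap.comp_apply, LinearMap.comp_apply, LinearMap.comp_apply]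
  have e6 : cutCommR (hBdY i h) (hIbY i h) (QsY i parB U) (aY i (QY i parB U A)) b = 0 := by
    rw [cutCommR_QsY]
    refine trLiftY_apply_eq_zero_of _ _ _ b fun y hy => aY_apply_eq_zero_of i (hQ y ?_)
    rw [Matrix.of_apply] at hy
    exact left_ne_zero_of_mul hy
  have e7 : QsY i parB U (aY i (cutCommR (hIbY i h) (hBdY i h) (QY i parB U) A)) b = 0 := by
    refine trLiftY_apply_eq_zero_of (qsK i) _ _ b fun y hy => aY_apply_eq_zero_of i ?_
    rw [cutCommR_QY]
    refine trLiftY_apply_eq_zero_of _ _ A y fun f hf => hA y f hy ?_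
    rw [Matrix.of_apply] at hf
    exact left_ne_zero_of_mul hf
  rw [e6, e7, add_zero]

/-- **THE AVERAGING ALTERNATIVE**: where `[h,Q*aQ]Λ(b′) ≠ 0`, some coarse bond `y` averages `b′` and `h` varies across its double block: `h(corner βy) ≠ h(b′₋)`
or `h(f₋) ≠ h(corner βy)` for a fine bond `f` averaged by `y`. [cite: Balaban1985BackgroundPropagators, (3.102)–(3.103) p.414] -/
theorem avg_alternative (h : SiteY i → ℝ) (parB : BondParY 𝔸 i) (U : CfgY 𝔸 i) (A : FBondY i → 𝔸) (b : FBondY i)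
    (hne : cutCommR (hBdY i h) (hBdY i h) (QsY i parB U ∘ₗ aY i ∘ₗ QY i parB U) A b ≠ 0) :
    ∃ y : IBondY i, qsK i b y ≠ 0 ∧ (h (blkCornerY i (β i.hN i.D i.hk y)) ≠ h (chartY i b.src) ∨
      ∃ f : FBondY i, qK i y f ≠ 0 ∧ h (chartY i f.src) ≠ h (blkCornerY i (β i.hN i.D i.hk y))) := by
  by_contra H
  push Not at H
  apply hne
  rw [cutCommR_QsY_aY_QY, LinearMap.add_apply, Pi.add_apply, LinearMap.comp_apply, LinearMap.comp_apply, LinearMap.comp_apply, LinearMap.comp_apply]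
  have e6 : cutCommR (hBdY i h) (hIbY i h) (QsY i parB U) (aY i (QY i parB U A)) b = 0 := by
    refine cutCommR_trLiftY_apply_eq_zero_of (hBdY i h) (hIbY i h) (qsK i) _ _ b fun y hy => ?_
    exact ((H y hy).1).symm
  have e7 : QsY i parB U (aY i (cutCommR (hIbY i h) (hBdY i h) (QY i parB U) A)) b = 0 := by
    refine trLiftY_apply_eq_zero_of (qsK i) _ _ b fun y hy => aY_apply_eq_zero_of i ?_
    refine cutCommR_trLiftY_apply_eq_zero_of (hIbY i h) (hBdY i h) (qK i) _ A y fun f hf => ?_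
    exact ((H y hy).2 f hf).symm
  rw [e6, e7, add_zero]

/-- **THE WINDOW OF THE AVERAGING TERM**: where `[h_□,Q*aQ]Λ(b′) ≠ 0`, `j − 2 ≤ lev b′ ≤ j + 2` (the varying site carries `h_□ ≠ 0`, so its level is in
`[j−1, j+1]`; the double block spans two levels). [cite: Balaban1984PropagatorsII, (2.2)–(2.4) p.224, p.235; Balaban1985BackgroundPropagators, (3.102) p.414] -/
theorem avg_window (c : ↥(cubes i.D.toDomains)) (parB : BondParY 𝔸 i) (U : CfgY 𝔸 i) (A : FBondY i → 𝔸) (b : FBondY i)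
    (hne : cutCommR (hBdY i (hTY i c)) (hBdY i (hTY i c)) (QsY i parB U ∘ₗ aY i ∘ₗ QY i parB U) A b ≠ 0) :
    levY i (chartY i b.src) ≤ c.1.1 + 2 ∧ c.1.1 ≤ levY i (chartY i b.src) + 2 := by
  obtain ⟨y, hy, halt⟩ := avg_alternative i (hTY i c) parB U A b hne
  have hb := levY_src_bounds_of_qwt_ne_zero i (qwt_ne_zero_of_qsK_ne_zero i hy)
  have hcor := levY_blkCornerY_beta i y
  -- a site `u` with `h_□(u) ≠ 0` and `lvl y − 1 ≤ lev u ≤ lvl y`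
  have key : ∃ u : SiteY i, hTY i c u ≠ 0 ∧ lvl i.hN i.D i.hk y - 1 ≤ levY i u ∧ levY i u ≤ lvl i.hN i.D i.hk y := by
    rcases halt with h1 | ⟨f, hf, h2⟩
    · by_cases h0 : hTY i c (blkCornerY i (β i.hN i.D i.hk y)) = 0
      · refine ⟨chartY i b.src, fun h' => h1 (by rw [h0, h']), hb.1, hb.2⟩
      · exact ⟨_, h0, by omega, le_of_eq hcor⟩
    · have hfb := levY_src_bounds_of_qwt_ne_zero i (qwt_ne_zero_of_qK_ne_zero i hf)
      by_cases h0 : hTY i c (blkCornerY i (β i.hN i.D i.hk y)) = 0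
      · refine ⟨chartY i f.src, fun h' => h2 (by rw [h0, h']), hfb.1, hfb.2⟩
      · exact ⟨_, h0, by omega, le_of_eq hcor⟩
  obtain ⟨u, hu, hu1, hu2⟩ := key
  have w1 : levY i u ≤ c.1.1 + 1 := (mem_QT_and_lev_of_near i c hu (torusSupNorm_sub_self_le_one i u)).2
  have w2 : c.1.1 ≤ levY i u + 1 := le_levY_succ_of_near_hTY i c hu (torusSupNorm_sub_self_le_one i u)
  omega

include hΛ hι hs in
/-- **THE SUPPORT OF THE AVERAGING TERM**: where `[h,Q*aQ]Λ(b′) ≠ 0`, the block of `b′` is within `2L + 4` of `βy′` (two double blocks, [4] (2.45)).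
[cite: Balaban1984PropagatorsII, (2.45) p.231; Balaban1985BackgroundPropagators, (3.102)–(3.103) p.414] -/
theorem near_avg (h : SiteY i → ℝ) (parB : BondParY 𝔸 i) (U : CfgY 𝔸 i) (b : FBondY i)
    (hne : cutCommR (hBdY i h) (hBdY i h) (QsY i parB U ∘ₗ aY i ∘ₗ QY i parB U) Λ b ≠ 0) :
    (geo9K i).dist (ιB (blkV1 i.hN i.D b)) y' ≤ 2 * (ℓ : ℝ) + 6 := by
  by_contra hfar
  apply hne
  refine avg_apply_eq_zero_of i h parB U Λ b fun y f hy hf => ?_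
  by_contra hΛ0
  have hJ : J f ≠ 0 := fun h0 => hΛ0 (norm_le_zero_iff.1 ((hΛ _).trans (by rw [h0, abs_zero])))
  have hblk : blkV1 i.hN i.D f = β i.hN i.D i.hk y' := hs f hJ
  have d1 := dist_blkV1_beta_le_of_qwt_ne_zero i (qwt_ne_zero_of_qsK_ne_zero i hy)
  have d2 := dist_blkV1_beta_le_of_qwt_ne_zero i (qwt_ne_zero_of_qK_ne_zero i hf)
  have t := dist_bondT_triangle i (blkV1 i.hN i.D b) (β i.hN i.D i.hk y) (blkV1 i.hN i.D f)
  rw [SimpleGraph.dist_comm] at d2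
  apply hfar
  rw [geo9K_dist_eq, hι, ← hblk]
  linarith

include hΛ hι hs in
/-- **THE SUPPORT OF `[h,Δ′₂]Λ`**: where `[h_□,Δ′₂]Λ(b′) ≠ 0`, `Λ ≠ 0` on some contour bond of a plaquette through `b′`, so `d(ιBΔ(b′), y′) ≤ 2`.
[cite: Balaban1985BackgroundPropagators, (3.10) p.392, p.414; Balaban1984PropagatorsII, (2.51) p.232] -/
theorem near_curv (c : ↥(cubes i.D.toDomains)) (hU : ∀ μ x, ‖(U μ x : 𝔸)‖ ≤ 1 ∧ ‖(((U μ x)⁻¹ : 𝔸ˣ) : 𝔸)‖ ≤ 1) {b : FBondY i}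
    (hne : cutCommR (hBdY i (hTY i c)) (hBdY i (hTY i c)) (curv2Y i U) Λ b ≠ 0) :
    (geo9K i).dist (ιB (blkV1 i.hN i.D b)) y' ≤ 2 := by
  by_contra hfar
  apply hne
  -- all contour values vanish, so E′₁-loc's bound with `G₀ = 0` forces the term to vanish
  have hA : ∀ (p : PlaqY i) (m l : Fin 4), edgeY i p m = b → ‖Λ (edgeY i p l)‖ ≤ 0 := by
    intro p m l hm
    refine norm_le_zero_iff.2 ?_
    by_contra hΛ0
    have hJ : J (edgeY i p l) ≠ 0 := fun h0 => hΛ0 (norm_le_zero_iff.1 ((hΛ _).trans (by rw [h0, abs_zero])))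
    have hblk : blkV1 i.hN i.D (edgeY i p l) = β i.hN i.D i.hk y' := hs _ hJ
    have t₁ : torusSupNorm (toKT i).NB ((chartY i b.src).1 - (chartY i p.src).1) ≤ 1 := by
      rw [← hm]; exact touch_symm i (touch_src_edgeY i p m)
    have hd2 := bd2_two i t₁ (touch_src_edgeY i p l)
    apply hfar
    rw [geo9K_dist_eq, hι, ← hblk]
    exact hd2
  have hI : ∀ (p : PlaqY i) (m : Fin 4), edgeY i p m = b → ‖((i.cf ^ 2 : ℝ) : ℂ) • imHolY i U p‖ ≤ i.cf ^ 2 * 2 := by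
    intro p m _
    have hb := bicontr_holY i U hU p
    rw [norm_smul, Complex.norm_real, Real.norm_eq_abs, abs_of_nonneg (sq_nonneg _)]
    refine mul_le_mul_of_nonneg_left ?_ (sq_nonneg _)
    unfold imHolY
    rw [norm_smul]
    have hn : ‖(-Complex.I / 2 : ℂ)‖ = 1 / 2 := by simp
    have := norm_sub_le ((holY i U p : 𝔸ˣ) : 𝔸) (((holY i U p)⁻¹ : 𝔸ˣ) : 𝔸)
    nlinarith [hb.1, hb.2, norm_nonneg (-Complex.I / 2 : ℂ), hn]
  have key := norm_cutCommR_curv2Y_hTY_apply_le_loc i c U hU (by positivity : (0 : ℝ) ≤ i.cf ^ 2 * 2) Λ b hI le_rfl hA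
  rw [mul_zero] at key
  exact norm_le_zero_iff.1 key

/-- **THE WINDOW OF `[h,Δ′₂]Λ`**: where `[h_□,Δ′₂]Λ(b′) ≠ 0`, `h_□` varies across a plaquette through `b′`, so every plaquette `p` through `b′` has
`j ≤ lev p₀ + 3`. [cite: Balaban1984PropagatorsII, (2.2) p.224, p.235; Balaban1985BackgroundPropagators, p.414] -/
theorem curv_window (c : ↥(cubes i.D.toDomains)) (U : CfgY 𝔸 i) (A : FBondY i → 𝔸) {b : FBondY i}
    (hne : cutCommR (hBdY i (hTY i c)) (hBdY i (hTY i c)) (curv2Y i U) A b ≠ 0) (p : PlaqY i) (m : Fin 4) (hm : edgeY i p m = b) :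
    c.1.1 ≤ levY i (chartY i p.src) + 3 := by
  have H : ¬ ∀ (p : PlaqY i) (m l : Fin 4), edgeY i p m = b → hTY i c (chartY i (edgeY i p l).src) = hTY i c (chartY i b.src) :=
    fun H => hne (cutCommR_curv2Y_apply_eq_zero_of i U (hTY i c) A b H)
  push Not at H
  obtain ⟨p₀, m₀, l₀, hm₀, hneq⟩ := H
  have t₁ : torusSupNorm (toKT i).NB ((chartY i b.src).1 - (chartY i p₀.src).1) ≤ 1 := by
    rw [← hm₀]; exact touch_symm i (touch_src_edgeY i p₀ m₀)
  -- a site with `h_□ ≠ 0` one step from `p₀₋`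
  have key : ∃ u : SiteY i, hTY i c u ≠ 0 ∧ torusSupNorm (toKT i).NB ((chartY i p₀.src).1 - u.1) ≤ 1 := by
    by_cases h0 : hTY i c (chartY i b.src) = 0
    · exact ⟨chartY i (edgeY i p₀ l₀).src, fun h' => hneq (by rw [h0, h']), touch_src_edgeY i p₀ l₀⟩
    · exact ⟨chartY i b.src, h0, touch_symm i t₁⟩
  obtain ⟨u, hu, hpu⟩ := key
  have w0 : c.1.1 ≤ levY i (chartY i p₀.src) + 1 := le_levY_succ_of_near_hTY i c hu hpu
  have wb : levY i (chartY i p₀.src) ≤ levY i (chartY i b.src) + 1 := lev_le_succ_of_touch i t₁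
  have t₂ : torusSupNorm (toKT i).NB ((chartY i p.src).1 - (chartY i b.src).1) ≤ 1 := by
    rw [← hm]; exact touch_src_edgeY i p m
  have wp : levY i (chartY i b.src) ≤ levY i (chartY i p.src) + 1 := lev_le_succ_of_touch i t₂
  omega

end Supports

/-! ## §6 ★★ The transposed (3.89) of the bond sector, pointwise over the class -/

section Main

variable {B₀ δ : ℝ}

set_option maxHeartbeats 1600000 in
/-- ★★ **THE TRANSPOSED (3.89), BOND SECTOR, POINTWISE OVER THE INVARIANT CLASS.**  For the cut-off `h_□` of the cover of record (`□` of level `j`),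
`η = |c_f|⁻¹`, bi-contractive bond variables and averaging transporters, plaquette variables with `‖U(∂p) − 1‖ ≤ δ̂·(L^{lev p₀})⁻²` (E′₅'s datum; print's
(3.35) ∕ (3.69) class), a ℂ-linear `O` on bond functions whose (3.42)₁ and (3.42)₃ entries over the class are displayed (`h342₀`, `h342₂`: the cube letter
`G_□(U)`), neighbourhood counts `m₂` (radius `2`) and `m_Q` (radius `2L+6`) of the index geometry ([4] (2.61)), and `‖Λ‖ ≤ |J|` with `J` supported in
`Δ(βy′)`: for `b ∈ Δ(βy)`,
`‖h_□(b₋)·(O K(h_□)(U)Λ)(b)‖ ≤ B₀·[(d+1)m₂e^{2δ}·((2(d+1)+4)·(5∕8)C1F∕M_h + (5∕8)²(C2F+2C2X)∕M_h² + 8δ̂L⁵(5∕8)C1F∕M_h + 64δ̂L⁷(5∕8)C1F∕M_h)`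
`+ m_Qe^{δ(2L+4)}·4b₁L⁶(L^{d+1})⁵·(sLipT∕(LM_h))(L+3)]·e^{−δd(y,y′)}·|J|` — print's «O(M⁻¹)B₀e^{−δ₀d(y,y′)}» for the transposed term `h_□G_□K(h_□)` of (3.105),
«exactly the bound (2.44) of [4]», with the window bookkeeping of [4] p. 235 making it uniform in `j`.
[cite: Balaban1985BackgroundPropagators, (3.89) p.409, p.414 l.1–6, p.415, Thm 3.3 (3.42) p.397; Balaban1984PropagatorsII, (2.44) p.230, (2.51)–(2.52) p.232, p.247] -/
theorem norm_hTY_O_KhBY_apply_le (c : ↥(cubes i.D.toDomains)) (parB : BondParY 𝔸 i) (U : CfgY 𝔸 i)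
    (O : (FBondY i → 𝔸) →ₗ[ℂ] (FBondY i → 𝔸)) (hB₀ : 0 ≤ B₀) (hδ : 0 ≤ δ)
    (hη : etaS i = |i.cf|⁻¹) (ιB : BlkY i → IBondY i) (hι : ∀ s, β i.hN i.D i.hk (ιB s) = s)
    (hU : ∀ μ x, ‖(U μ x : 𝔸)‖ ≤ 1 ∧ ‖(((U μ x)⁻¹ : 𝔸ˣ) : 𝔸)‖ ≤ 1)
    (hT : ∀ (y : IBondY i) (f : FBondY i), ‖(qT i parB U y f : 𝔸)‖ ≤ 1 ∧ ‖(((qT i parB U y f)⁻¹ : 𝔸ˣ) : 𝔸)‖ ≤ 1)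
    {δh : ℝ} (hδh : 0 ≤ δh)
    (hW : ∀ p : PlaqY i, ‖((holY i U p : 𝔸ˣ) : 𝔸) - 1‖ ≤ δh * ((((ℓ : ℝ) + 1) ^ levY i (chartY i p.src))⁻¹) ^ 2)
    (h342₀ : ∀ (J : FBondY i → ℝ) (y y' : IBondY i), (geo9K i).suppIn (Sum.inr J) y' →
      ∀ Λ : FBondY i → 𝔸, (∀ x, ‖Λ x‖ ≤ |J x|) → ∀ x : FBondY i, blkV1 i.hN i.D x = β i.hN i.D i.hk y →
        ‖O Λ x‖ ≤ B₀ * (geo9K i).len y ^ 2 * Real.exp (-(δ * (geo9K i).dist y y')) * (geo9K i).supNorm (Sum.inr J))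
    (h342₂ : ∀ (J : FBondY i → ℝ) (y y' : IBondY i), (geo9K i).suppIn (Sum.inr J) y' →
      ∀ Λ : FBondY i → 𝔸, (∀ x, ‖Λ x‖ ≤ |J x|) → ∀ (x : FBondY i) (ν : Fin (d + 1)), blkV1 i.hN i.D x = β i.hN i.D i.hk y →
        ‖O (cdsB i U ν Λ) x‖ ≤ B₀ * (geo9K i).len y * Real.exp (-(δ * (geo9K i).dist y y')) * (geo9K i).supNorm (Sum.inr J))
    (T₂ : IBondY i → Finset (IBondY i)) (hT₂ : ∀ a y' : IBondY i, (geo9K i).dist a y' ≤ 2 → a ∈ T₂ y')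
    {m₂ : ℝ} (hm₂ : 0 ≤ m₂) (hnbr₂ : ∀ y' : IBondY i, ((T₂ y').card : ℝ) ≤ m₂)
    (TQ : IBondY i → Finset (IBondY i)) (hTQ : ∀ a y' : IBondY i, (geo9K i).dist a y' ≤ 2 * (ℓ : ℝ) + 6 → a ∈ TQ y')
    {mQ : ℝ} (hmQ : 0 ≤ mQ) (hnbrQ : ∀ y' : IBondY i, ((TQ y').card : ℝ) ≤ mQ)
    (J : FBondY i → ℝ) (y y' : IBondY i) (hs : (geo9K i).suppIn (Sum.inr J) y')
    (Λ : FBondY i → 𝔸) (hΛ : ∀ x, ‖Λ x‖ ≤ |J x|) (b : FBondY i) (hb : blkV1 i.hN i.D b = β i.hN i.D i.hk y) :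
    ‖cutMulY (hBdY i (hTY i c)) (O (KhBY i (hTY i c) parB U Λ)) b‖
      ≤ B₀ * (((d : ℝ) + 1) * m₂ * Real.exp (δ * 2)
              * ((2 * ((d : ℝ) + 1) + 4) * (5 / 8 * C1F d ℓ / i.Mh) + (5 / 8) ^ 2 * (C2F d ℓ + 2 * C2X d ℓ) / (i.Mh : ℝ) ^ 2
                  + 8 * δh * ((ℓ : ℝ) + 1) ^ 5 * (5 / 8 * C1F d ℓ / i.Mh) + 64 * δh * ((ℓ : ℝ) + 1) ^ 7 * (5 / 8 * C1F d ℓ / i.Mh))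
            + mQ * Real.exp (δ * (2 * (ℓ : ℝ) + 6))
              * (4 * b₁ * ((ℓ : ℝ) + 1) ^ 6 * (((ℓ : ℝ) + 1) ^ (d + 1)) ^ 5 * (sLipT d ℓ / (((ℓ : ℝ) + 1) * i.Mh) * (((ℓ : ℝ) + 1) + 3))))
        * Real.exp (-(δ * (geo9K i).dist y y')) * (geo9K i).supNorm (Sum.inr J) := by
  classical
  obtain ⟨_, hMh2, _, _⟩ := side_conditions i
  have hL1 : (1 : ℝ) ≤ (ℓ : ℝ) + 1 := by linarith [(Nat.cast_nonneg ℓ : (0 : ℝ) ≤ ℓ)]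
  have hL0 : (0 : ℝ) < (ℓ : ℝ) + 1 := by linarith
  have hM : (0 : ℝ) < i.Mh := by exact_mod_cast (lt_of_lt_of_le (by norm_num) hMh2)
  have hM1 : (1 : ℝ) ≤ i.Mh := by exact_mod_cast (le_trans (by norm_num) hMh2)
  have hE0 : 0 ≤ Real.exp (-(δ * (geo9K i).dist y y')) := (Real.exp_pos _).le
  have hS0 : 0 ≤ (geo9K i).supNorm (Sum.inr J) := geo9K_supNorm_nonneg i _
  have hC1 : 0 ≤ C1F d ℓ := C1F_nonneg d ℓ
  have hC2 : 0 ≤ C2F d ℓ := C2F_nonneg d ℓ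
  have hC2X : 0 ≤ C2X d ℓ := (C2X_bounds d ℓ).2.2
  have hsL : 0 ≤ sLipT d ℓ := sLipT_nonneg d ℓ
  have hb1 : 0 ≤ b₁ := (b1_pos i y).le
  have hcf0 : 0 < |i.cf| := abs_pos.2 i.hcf
  -- abbreviations
  set Lr : ℝ := (ℓ : ℝ) + 1 with hLr
  set c₁ : ℝ := 5 / 8 * C1F d ℓ / i.Mh with hc₁
  set c₂ : ℝ := (5 / 8) ^ 2 * C2F d ℓ / (i.Mh : ℝ) ^ 2 with hc₂
  set c₂ₓ : ℝ := (5 / 8) ^ 2 * C2X d ℓ / (i.Mh : ℝ) ^ 2 with hc₂ₓ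
  set Cs : ℝ := sLipT d ℓ / (Lr * i.Mh) with hCs
  set E : ℝ := Real.exp (-(δ * (geo9K i).dist y y')) with hE
  set S : ℝ := (geo9K i).supNorm (Sum.inr J) with hS
  set e2 : ℝ := Real.exp (δ * 2) with he2
  set eQ : ℝ := Real.exp (δ * (2 * (ℓ : ℝ) + 6)) with heQ
  set κ₁ : ℝ := C1F d ℓ / (8 / 5 * (bigSide ℓ i.Mh c.1.1 : ℝ)) with hκ₁
  set κ₂ : ℝ := C2F d ℓ / (8 / 5 * (bigSide ℓ i.Mh c.1.1 : ℝ)) ^ 2 with hκ₂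
  set κ₂ₓ : ℝ := C2X d ℓ / (8 / 5 * (bigSide ℓ i.Mh c.1.1 : ℝ)) ^ 2 with hκ₂ₓ
  set wt : ℝ := ((Lr ^ c.1.1)⁻¹) ^ 2 with hwt
  set a : ℝ := |i.cf| with ha
  have hc₁0 : 0 ≤ c₁ := by positivity
  have hc₂0 : 0 ≤ c₂ := by positivity
  have hc₂ₓ0 : 0 ≤ c₂ₓ := by positivity
  have hCs0 : 0 ≤ Cs := by positivity
  have hκ₁0 : 0 ≤ κ₁ := div_nonneg hC1 (by positivity)
  have hκ₂0 : 0 ≤ κ₂ := div_nonneg hC2 (by positivity)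
  have hκ₂ₓ0 : 0 ≤ κ₂ₓ := div_nonneg hC2X (by positivity)
  have hwt0 : 0 ≤ wt := by positivity
  have hRHS : 0 ≤ B₀ * (((d : ℝ) + 1) * m₂ * e2 * ((2 * ((d : ℝ) + 1) + 4) * c₁ + (5 / 8) ^ 2 * (C2F d ℓ + 2 * C2X d ℓ) / (i.Mh : ℝ) ^ 2
      + 8 * δh * Lr ^ 5 * c₁ + 64 * δh * Lr ^ 7 * c₁) + mQ * eQ * (4 * b₁ * Lr ^ 6 * (Lr ^ (d + 1)) ^ 5 * (Cs * (Lr + 3)))) * E * S := by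
    positivity
  set h : SiteY i → ℝ := hTY i c with hh
  -- output localisation: the factor `h_□(b₋)`
  obtain ⟨x₀, hx₀⟩ : ∃ x₀, x₀ = chartY i b.src := ⟨_, rfl⟩
  by_cases hz0 : h x₀ = 0
  · rw [cutMulY_apply, hBdY_apply, ← hx₀, hz0, Complex.ofReal_zero, zero_smul, norm_zero]; exact hRHS
  have hlevx : levY i x₀ ≤ c.1.1 + 1 := (mem_QT_and_lev_of_near i c hz0 (torusSupNorm_sub_self_le_one i x₀)).2
  have hh1 : |h x₀| ≤ 1 := abs_hT_le_one i.D (one_le_Mh i) (one_le_P i) c x₀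
  -- the length of the output block and the level bookkeeping
  have hbx : blkOf i.D.toDomains x₀ = β i.hN i.D i.hk y := by rw [hx₀]; exact hb
  have hlen : (geo9K i).len y = Lr ^ levY i x₀ * a⁻¹ := by rw [len_eq_pow_mul_eta i hη hbx, hη]
  set Lx : ℝ := Lr ^ levY i x₀ with hLx
  have hLx0 : 0 < Lx := pow_pos hL0 _
  have hLj : (0 : ℝ) < Lr ^ c.1.1 := pow_pos hL0 _
  have hpow : Lx ≤ Lr ^ c.1.1 * Lr := (pow_le_pow_right₀ hL1 hlevx).trans (le_of_eq (pow_succ _ _))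
  have hκpow : κ₁ * Lx ≤ c₁ := by
    rw [hκ₁, C1F_div_bigSide_eq i c.1.1]
    have hq : (Lr ^ c.1.1)⁻¹ * Lx ≤ Lr := by rw [inv_mul_le_iff₀ hLj]; exact hpow
    calc 5 / 8 * C1F d ℓ / (Lr * i.Mh) * (Lr ^ c.1.1)⁻¹ * Lx = 5 / 8 * C1F d ℓ / (Lr * i.Mh) * ((Lr ^ c.1.1)⁻¹ * Lx) := by ring
      _ ≤ 5 / 8 * C1F d ℓ / (Lr * i.Mh) * Lr := mul_le_mul_of_nonneg_left hq (by positivity)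
      _ = c₁ := by rw [hc₁]; field_simp
  have hκL : κ₁ * Lr ≤ c₁ := by
    rw [hκ₁, C1F_div_bigSide_eq i c.1.1]
    have hq : (Lr ^ c.1.1)⁻¹ ≤ 1 := inv_le_one_of_one_le₀ (one_le_pow₀ hL1)
    calc 5 / 8 * C1F d ℓ / (Lr * i.Mh) * (Lr ^ c.1.1)⁻¹ * Lr = 5 / 8 * C1F d ℓ / (Lr * i.Mh) * Lr * (Lr ^ c.1.1)⁻¹ := by ring
      _ ≤ 5 / 8 * C1F d ℓ / (Lr * i.Mh) * Lr * 1 := mul_le_mul_of_nonneg_left hq (by positivity)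
      _ = c₁ := by rw [hc₁]; field_simp
  have hsq : ((Lr ^ c.1.1) ^ 2)⁻¹ * Lx ^ 2 ≤ Lr ^ 2 := by
    rw [inv_mul_le_iff₀ (pow_pos hLj 2), ← mul_pow]
    exact pow_le_pow_left₀ (by positivity) hpow 2
  have hκ2pow : κ₂ * Lx ^ 2 ≤ c₂ := by
    rw [hκ₂, C2F_div_bigSide_sq_eq i c.1.1]
    calc (5 / 8) ^ 2 * C2F d ℓ / (Lr * i.Mh) ^ 2 * ((Lr ^ c.1.1) ^ 2)⁻¹ * Lx ^ 2
        = (5 / 8) ^ 2 * C2F d ℓ / (Lr * i.Mh) ^ 2 * (((Lr ^ c.1.1) ^ 2)⁻¹ * Lx ^ 2) := by ring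
      _ ≤ (5 / 8) ^ 2 * C2F d ℓ / (Lr * i.Mh) ^ 2 * Lr ^ 2 := mul_le_mul_of_nonneg_left hsq (by positivity)
      _ = c₂ := by rw [hc₂]; field_simp
  have hκ2xpow : κ₂ₓ * Lx ^ 2 ≤ c₂ₓ := by
    rw [hκ₂ₓ, C2X_div_bigSide_sq_eq i c]
    calc (5 / 8) ^ 2 * C2X d ℓ / ((Lr * i.Mh) ^ 2) * ((Lr ^ c.1.1) ^ 2)⁻¹ * Lx ^ 2
        = (5 / 8) ^ 2 * C2X d ℓ / ((Lr * i.Mh) ^ 2) * (((Lr ^ c.1.1) ^ 2)⁻¹ * Lx ^ 2) := by ring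
      _ ≤ (5 / 8) ^ 2 * C2X d ℓ / ((Lr * i.Mh) ^ 2) * Lr ^ 2 := mul_le_mul_of_nonneg_left hsq (by positivity)
      _ = c₂ₓ := by rw [hc₂ₓ]; field_simp
  have hLxwt : Lx ^ 2 * wt ≤ Lr ^ 2 := by rw [hwt, inv_pow, mul_comm]; exact hsq
  -- the decomposition of `K(h_□)Λ` and its image under `O`
  have hKfun : KhBY i h parB U Λ
      = (∑ μ : Fin (d + 1), cdsB i U μ (dCurl i h U Λ μ))
        + (∑ μ : Fin (d + 1), cdsB i U μ (Jb i U μ (dDiv i h U Λ)))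
        + (∑ μ : Fin (d + 1), cdsB i U μ (dMul i h Λ μ))
        + (∑ μ : Fin (d + 1), ∑ lam : Fin (d + 1), cdsB i U lam (Jb i U lam (dBwd i h U Λ μ)))
        + (∑ μ : Fin (d + 1), cdsB i U μ (dFwd i h U Λ μ))
        + (∑ μ : Fin (d + 1), (zSec i h U Λ μ + zMixB i h U Λ μ + zHolB i h U Λ μ + zJor i h U Λ μ + zMixF i h U Λ μ + zHolF i h U Λ μ))
        + cutCommR (hBdY i h) (hBdY i h) (curv2Y i U) Λ
        + cutCommR (hBdY i h) (hBdY i h) (QsY i parB U ∘ₗ aY i ∘ₗ QY i parB U) Λ := by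
    funext b'
    simp only [Pi.add_apply, Finset.sum_apply]
    exact KhBY_apply_transposed i h parB U Λ b'
  have hOK : O (KhBY i h parB U Λ) b
      = (∑ μ : Fin (d + 1), O (cdsB i U μ (dCurl i h U Λ μ)) b)
        + (∑ μ : Fin (d + 1), O (cdsB i U μ (Jb i U μ (dDiv i h U Λ))) b)
        + (∑ μ : Fin (d + 1), O (cdsB i U μ (dMul i h Λ μ)) b)
        + (∑ μ : Fin (d + 1), ∑ lam : Fin (d + 1), O (cdsB i U lam (Jb i U lam (dBwd i h U Λ μ))) b)
        + (∑ μ : Fin (d + 1), O (cdsB i U μ (dFwd i h U Λ μ)) b)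
        + (∑ μ : Fin (d + 1), (O (zSec i h U Λ μ) b + O (zMixB i h U Λ μ) b + O (zHolB i h U Λ μ) b + O (zJor i h U Λ μ) b
            + O (zMixF i h U Λ μ) b + O (zHolF i h U Λ μ) b))
        + O (cutCommR (hBdY i h) (hBdY i h) (curv2Y i U) Λ) b
        + O (cutCommR (hBdY i h) (hBdY i h) (QsY i parB U ∘ₗ aY i ∘ₗ QY i parB U) Λ) b := by
    rw [hKfun]
    simp only [map_add, map_sum, Pi.add_apply, Finset.sum_apply]
  -- the two readings, specialised
  have hUb : ∀ μ (z : SiteY i), ‖(UboxY i U μ z : 𝔸)‖ ≤ 1 ∧ ‖(((UboxY i U μ z)⁻¹ : 𝔸ˣ) : 𝔸)‖ ≤ 1 := fun μ z => hU μ _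
  have read₂ : ∀ (Ψ : FBondY i → 𝔸) {C : ℝ}, 0 ≤ C → (∀ w, ‖Ψ w‖ ≤ C) → (∀ w, Ψ w ≠ 0 → (geo9K i).dist (ιB (blkV1 i.hN i.D w)) y' ≤ 2) →
      ∀ ν, ‖O (cdsB i U ν Ψ) b‖ ≤ m₂ * e2 * (B₀ * (Lx * a⁻¹)) * E * C := by
    intro Ψ C hC hΨC hnear ν
    have h1 := norm_O_cdsB_le_of_near i U O hB₀ hδ ιB hι h342₂ T₂ hT₂ hnbr₂ y y' Ψ hC hΨC hnear b ν hb
    rw [hlen] at h1; exact h1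
  have read₀ : ∀ (Ψ : FBondY i → 𝔸) {C : ℝ}, 0 ≤ C → (∀ w, ‖Ψ w‖ ≤ C) → (∀ w, Ψ w ≠ 0 → (geo9K i).dist (ιB (blkV1 i.hN i.D w)) y' ≤ 2) →
      ‖O Ψ b‖ ≤ m₂ * e2 * (B₀ * (Lx * a⁻¹) ^ 2) * E * C := by
    intro Ψ C hC hΨC hnear
    have h1 := norm_O_le_of_near i O hB₀ hδ ιB hι h342₀ T₂ hT₂ hnbr₂ y y' Ψ hC hΨC hnear b hb
    rw [hlen] at h1; exact h1
  have readQ : ∀ (Ψ : FBondY i → 𝔸) {C : ℝ}, 0 ≤ C → (∀ w, ‖Ψ w‖ ≤ C) →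
      (∀ w, Ψ w ≠ 0 → (geo9K i).dist (ιB (blkV1 i.hN i.D w)) y' ≤ 2 * (ℓ : ℝ) + 6) →
      ‖O Ψ b‖ ≤ mQ * eQ * (B₀ * (Lx * a⁻¹) ^ 2) * E * C := by
    intro Ψ C hC hΨC hnear
    have h1 := norm_O_le_of_near i O hB₀ hδ ιB hι h342₀ TQ hTQ hnbrQ y y' Ψ hC hΨC hnear b hb
    rw [hlen] at h1; exact h1
  have hme : 0 ≤ m₂ * e2 * B₀ := by positivity
  -- (D) the five `∇*`-inputs: `ℓ(y)·|c_f|κ₁ = L^{lev}κ₁ ≤ c₁`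
  have keyD : Lx * a⁻¹ * (a * κ₁) = κ₁ * Lx := by field_simp
  have hD1 : ∀ μ, ‖O (cdsB i U μ (dCurl i h U Λ μ)) b‖ ≤ m₂ * e2 * B₀ * (2 * c₁) * E * S := fun μ => by
    have h1 := read₂ (dCurl i h U Λ μ) (by positivity) (norm_dCurl_le i c U Λ J hU hΛ μ) (fun w hw => near_dCurl i U Λ J hΛ ιB hι hs h μ hw) μ
    have e : m₂ * e2 * (B₀ * (Lx * a⁻¹)) * E * (2 * a * κ₁ * S) = m₂ * e2 * B₀ * (2 * (κ₁ * Lx)) * E * S := by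
      rw [← keyD]; ring
    rw [e] at h1
    exact h1.trans (mul_le_mul_of_nonneg_right (mul_le_mul_of_nonneg_right (mul_le_mul_of_nonneg_left (by linarith) hme) hE0) hS0)
  have hD2 : ∀ μ, ‖O (cdsB i U μ (Jb i U μ (dDiv i h U Λ))) b‖ ≤ m₂ * e2 * B₀ * (((d : ℝ) + 1) * c₁) * E * S := fun μ => by
    have hC : ∀ w, ‖Jb i U μ (dDiv i h U Λ) w‖ ≤ a * (((d : ℝ) + 1) * κ₁ * S) := fun w =>
      (norm_Jb_le i U hU μ _ w).trans (norm_dDiv_le i c U Λ J hU hΛ _)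
    have h1 := read₂ (Jb i U μ (dDiv i h U Λ)) (by positivity) hC (fun w hw => near_Jb_dDiv i U Λ J hΛ ιB hι hs h μ hw) μ
    have e : m₂ * e2 * (B₀ * (Lx * a⁻¹)) * E * (a * (((d : ℝ) + 1) * κ₁ * S)) = m₂ * e2 * B₀ * (((d : ℝ) + 1) * (κ₁ * Lx)) * E * S := by
      rw [← keyD]; ring
    rw [e] at h1
    refine h1.trans (mul_le_mul_of_nonneg_right (mul_le_mul_of_nonneg_right (mul_le_mul_of_nonneg_left ?_ hme) hE0) hS0)
    exact mul_le_mul_of_nonneg_left hκpow (by positivity)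
  have hD3 : ∀ μ, ‖O (cdsB i U μ (dMul i h Λ μ)) b‖ ≤ m₂ * e2 * B₀ * c₁ * E * S := fun μ => by
    have h1 := read₂ (dMul i h Λ μ) (by positivity) (norm_dMul_le i c Λ J hΛ μ) (fun w hw => near_dMul i Λ J hΛ ιB hι hs h μ hw) μ
    have e : m₂ * e2 * (B₀ * (Lx * a⁻¹)) * E * (a * κ₁ * S) = m₂ * e2 * B₀ * (κ₁ * Lx) * E * S := by rw [← keyD]; ring
    rw [e] at h1
    exact h1.trans (mul_le_mul_of_nonneg_right (mul_le_mul_of_nonneg_right (mul_le_mul_of_nonneg_left hκpow hme) hE0) hS0)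
  have hD4 : ∀ μ lam, ‖O (cdsB i U lam (Jb i U lam (dBwd i h U Λ μ))) b‖ ≤ m₂ * e2 * B₀ * c₁ * E * S := fun μ lam => by
    have hC : ∀ w, ‖Jb i U lam (dBwd i h U Λ μ) w‖ ≤ a * κ₁ * S := fun w =>
      (norm_Jb_le i U hU lam _ w).trans (norm_dBwd_le i c U Λ J hU hΛ μ _)
    have h1 := read₂ (Jb i U lam (dBwd i h U Λ μ)) (by positivity) hC (fun w hw => near_Jb_dBwd i U Λ J hΛ ιB hι hs h μ lam hw) lam
    have e : m₂ * e2 * (B₀ * (Lx * a⁻¹)) * E * (a * κ₁ * S) = m₂ * e2 * B₀ * (κ₁ * Lx) * E * S := by rw [← keyD]; ring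
    rw [e] at h1
    exact h1.trans (mul_le_mul_of_nonneg_right (mul_le_mul_of_nonneg_right (mul_le_mul_of_nonneg_left hκpow hme) hE0) hS0)
  have hD5 : ∀ μ, ‖O (cdsB i U μ (dFwd i h U Λ μ)) b‖ ≤ m₂ * e2 * B₀ * c₁ * E * S := fun μ => by
    have h1 := read₂ (dFwd i h U Λ μ) (by positivity) (norm_dFwd_le i c U Λ J hU hΛ μ) (fun w hw => near_dFwd i U Λ J hΛ ιB hι hs h μ hw) μ
    have e : m₂ * e2 * (B₀ * (Lx * a⁻¹)) * E * (a * κ₁ * S) = m₂ * e2 * B₀ * (κ₁ * Lx) * E * S := by rw [← keyD]; ring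
    rw [e] at h1
    exact h1.trans (mul_le_mul_of_nonneg_right (mul_le_mul_of_nonneg_right (mul_le_mul_of_nonneg_left hκpow hme) hE0) hS0)
  -- (Z) the six remainders: `ℓ(y)²c_f²κ₂ = L^{2lev}κ₂ ≤ c₂`; plaquette factors `L^{2lev}·(L^{lev w})⁻² ≤ L⁶` on the window
  have hcf2 : i.cf ^ 2 = a ^ 2 := by rw [ha, sq_abs]
  have keyZ : ∀ t : ℝ, (Lx * a⁻¹) ^ 2 * (a ^ 2 * t) = t * Lx ^ 2 := fun t => by field_simp
  have hZ1 : ∀ μ, ‖O (zSec i h U Λ μ) b‖ ≤ m₂ * e2 * B₀ * c₂ * E * S := fun μ => by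
    have hC : ∀ w, ‖zSec i h U Λ μ w‖ ≤ a ^ 2 * (κ₂ * S) := fun w => by rw [← hcf2]; exact norm_zSec_le i c U Λ J hU hΛ μ w
    have h1 := read₀ (zSec i h U Λ μ) (by positivity) hC (fun w hw => near_zSec i U Λ J hΛ ιB hι hs h μ hw)
    have e : m₂ * e2 * (B₀ * (Lx * a⁻¹) ^ 2) * E * (a ^ 2 * (κ₂ * S)) = m₂ * e2 * B₀ * (κ₂ * Lx ^ 2) * E * S := by
      have := keyZ κ₂
      calc m₂ * e2 * (B₀ * (Lx * a⁻¹) ^ 2) * E * (a ^ 2 * (κ₂ * S)) = m₂ * e2 * B₀ * ((Lx * a⁻¹) ^ 2 * (a ^ 2 * κ₂)) * E * S := by ring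
        _ = _ := by rw [this]
    rw [e] at h1
    exact h1.trans (mul_le_mul_of_nonneg_right (mul_le_mul_of_nonneg_right (mul_le_mul_of_nonneg_left hκ2pow hme) hE0) hS0)
  have hZmix : ∀ (Ψ : FBondY i → 𝔸), (∀ w, ‖Ψ w‖ ≤ i.cf ^ 2 * (κ₂ₓ * S)) → (∀ w, Ψ w ≠ 0 → (geo9K i).dist (ιB (blkV1 i.hN i.D w)) y' ≤ 2) →
      ‖O Ψ b‖ ≤ m₂ * e2 * B₀ * c₂ₓ * E * S := fun Ψ hC hnear => by
    have hC' : ∀ w, ‖Ψ w‖ ≤ a ^ 2 * (κ₂ₓ * S) := fun w => by rw [← hcf2]; exact hC w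
    have h1 := read₀ Ψ (by positivity) hC' hnear
    have e : m₂ * e2 * (B₀ * (Lx * a⁻¹) ^ 2) * E * (a ^ 2 * (κ₂ₓ * S)) = m₂ * e2 * B₀ * (κ₂ₓ * Lx ^ 2) * E * S := by
      have := keyZ κ₂ₓ
      calc m₂ * e2 * (B₀ * (Lx * a⁻¹) ^ 2) * E * (a ^ 2 * (κ₂ₓ * S)) = m₂ * e2 * B₀ * ((Lx * a⁻¹) ^ 2 * (a ^ 2 * κ₂ₓ)) * E * S := by ring
        _ = _ := by rw [this]
    rw [e] at h1
    exact h1.trans (mul_le_mul_of_nonneg_right (mul_le_mul_of_nonneg_right (mul_le_mul_of_nonneg_left hκ2xpow hme) hE0) hS0)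
  have hZ2 : ∀ μ, ‖O (zMixB i h U Λ μ) b‖ ≤ m₂ * e2 * B₀ * c₂ₓ * E * S := fun μ =>
    hZmix _ (norm_zMixB_le i c U Λ J hU hΛ μ) (fun w hw => near_zMixB i U Λ J hΛ ιB hι hs h μ hw)
  have hZ5 : ∀ μ, ‖O (zMixF i h U Λ μ) b‖ ≤ m₂ * e2 * B₀ * c₂ₓ * E * S := fun μ =>
    hZmix _ (norm_zMixF_le i c U Λ J hU hΛ μ) (fun w hw => near_zMixF i U Λ J hΛ ιB hι hs h μ hw)
  -- the window: a plaquette factor at a site `w` with `j ≤ lev w + n` is at most `(Lⁿ)²·wt`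
  have hwin : ∀ {w : SiteY i} {n : ℕ}, c.1.1 ≤ levY i w + n → ((Lr ^ levY i w)⁻¹) ^ 2 ≤ (Lr ^ n) ^ 2 * wt := fun {w n} hw =>
    inv_pow_sq_le_of_le_add hL1 hw
  -- plaquette-carrying remainders: uniform sup bound `a²κ₁·(t·δ̂L⁴wt)·S` via the window, then `L^{2lev}wt ≤ L²`, `κ₁L ≤ c₁`
  have hPl : ∀ (Ψ : FBondY i → 𝔸) (t : ℝ), 0 ≤ t → (∀ w, ‖Ψ w‖ ≤ a ^ 2 * (κ₁ * (t * δh * ((Lr ^ 2) ^ 2 * wt) * S))) →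
      (∀ w, Ψ w ≠ 0 → (geo9K i).dist (ιB (blkV1 i.hN i.D w)) y' ≤ 2) → ‖O Ψ b‖ ≤ m₂ * e2 * B₀ * (t * δh * Lr ^ 5 * c₁) * E * S := by
    intro Ψ t ht hC hnear
    have h1 := read₀ Ψ (by positivity) hC hnear
    have e : m₂ * e2 * (B₀ * (Lx * a⁻¹) ^ 2) * E * (a ^ 2 * (κ₁ * (t * δh * ((Lr ^ 2) ^ 2 * wt) * S)))
        = m₂ * e2 * B₀ * (t * δh * (Lr ^ 3 * ((κ₁ * Lr) * (Lx ^ 2 * wt)))) * E * S := by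
      have := keyZ (κ₁ * wt)
      calc m₂ * e2 * (B₀ * (Lx * a⁻¹) ^ 2) * E * (a ^ 2 * (κ₁ * (t * δh * ((Lr ^ 2) ^ 2 * wt) * S)))
          = m₂ * e2 * B₀ * (t * δh * (Lr ^ 2) ^ 2 * ((Lx * a⁻¹) ^ 2 * (a ^ 2 * (κ₁ * wt)))) * E * S := by ring
        _ = _ := by rw [this]; ring
    rw [e] at h1
    refine h1.trans (mul_le_mul_of_nonneg_right (mul_le_mul_of_nonneg_right (mul_le_mul_of_nonneg_left ?_ hme) hE0) hS0)
    have t1 : (κ₁ * Lr) * (Lx ^ 2 * wt) ≤ c₁ * Lr ^ 2 := mul_le_mul hκL hLxwt (by positivity) hc₁0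
    have t2 : Lr ^ 3 * ((κ₁ * Lr) * (Lx ^ 2 * wt)) ≤ Lr ^ 3 * (c₁ * Lr ^ 2) := mul_le_mul_of_nonneg_left t1 (by positivity)
    have : 0 ≤ t * δh := by positivity
    calc t * δh * (Lr ^ 3 * ((κ₁ * Lr) * (Lx ^ 2 * wt))) ≤ t * δh * (Lr ^ 3 * (c₁ * Lr ^ 2)) := mul_le_mul_of_nonneg_left t2 this
      _ = t * δh * Lr ^ 5 * c₁ := by ring
  have hZ3 : ∀ μ, ‖O (zHolB i h U Λ μ) b‖ ≤ m₂ * e2 * B₀ * (2 * δh * Lr ^ 5 * c₁) * E * S := fun μ => by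
    refine hPl (zHolB i h U Λ μ) 2 (by norm_num) (fun w => ?_) (fun w hw => near_zHolB i U Λ J hΛ ιB hι hs h μ hw)
    by_cases hw0 : zHolB i h U Λ μ w = 0
    · rw [hw0, norm_zero]; positivity
    · have hdg : dg i h μ (chartY i w.src) ≠ 0 := by
        intro h0; apply hw0; unfold zHolB; rw [h0, Complex.ofReal_zero, zero_smul, smul_zero, neg_zero]
      have hwn := hwin (window_of_dg_ne_zero i c μ _ hdg).1
      refine (norm_zHolB_le i c U Λ J hU hΛ hδh hW μ w).trans ?_
      rw [hcf2]
      have : 2 * δh * ((Lr ^ levY i ((shiftY i μ).symm (chartY i w.src)))⁻¹) ^ 2 * S ≤ 2 * δh * ((Lr ^ 2) ^ 2 * wt) * S :=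
        mul_le_mul_of_nonneg_right (mul_le_mul_of_nonneg_left hwn (by positivity)) hS0
      exact mul_le_mul_of_nonneg_left (mul_le_mul_of_nonneg_left this hκ₁0) (sq_nonneg _)
  have hZ6 : ∀ μ, ‖O (zHolF i h U Λ μ) b‖ ≤ m₂ * e2 * B₀ * (2 * δh * Lr ^ 5 * c₁) * E * S := fun μ => by
    refine hPl (zHolF i h U Λ μ) 2 (by norm_num) (fun w => ?_) (fun w hw => near_zHolF i U Λ J hΛ ιB hι hs h μ hw)
    by_cases hw0 : zHolF i h U Λ μ w = 0
    · rw [hw0, norm_zero]; positivity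
    · have hdg : dg i h w.dir (shiftY i w.dir (chartY i w.src)) ≠ 0 := by
        intro h0; apply hw0; unfold zHolF; rw [h0, Complex.ofReal_zero, zero_smul, smul_zero, neg_zero]
      have hwn := hwin (window_of_dg_shiftY_ne_zero i c μ w.dir _ hdg).1
      refine (norm_zHolF_le i c U Λ J hU hΛ hδh hW μ w).trans ?_
      rw [hcf2]
      have : 2 * δh * ((Lr ^ levY i ((shiftY i μ).symm (chartY i w.src)))⁻¹) ^ 2 * S ≤ 2 * δh * ((Lr ^ 2) ^ 2 * wt) * S :=
        mul_le_mul_of_nonneg_right (mul_le_mul_of_nonneg_left hwn (by positivity)) hS0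
      exact mul_le_mul_of_nonneg_left (mul_le_mul_of_nonneg_left this hκ₁0) (sq_nonneg _)
  have hZ4 : ∀ μ, ‖O (zJor i h U Λ μ) b‖ ≤ m₂ * e2 * B₀ * (4 * δh * Lr ^ 5 * c₁) * E * S := fun μ => by
    refine hPl (zJor i h U Λ μ) 4 (by norm_num) (fun w => ?_) (fun w hw => near_zJor i U Λ J hΛ ιB hι hs h μ hw)
    by_cases hw0 : zJor i h U Λ μ w = 0
    · rw [hw0, norm_zero]; positivity
    · have hdg : dg i h μ (chartY i w.src) ≠ 0 := by
        intro h0; apply hw0; unfold zJor; rw [h0, Complex.ofReal_zero, zero_smul, smul_zero]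
      have hwn := hwin (window_of_dg_ne_zero i c μ _ hdg).1
      refine (norm_zJor_le i c U Λ J hU hΛ hδh hW μ w).trans ?_
      have t1 : a * (δh * ((Lr ^ levY i ((shiftY i μ).symm (chartY i w.src)))⁻¹) ^ 2) * (4 * S) ≤ a * (δh * ((Lr ^ 2) ^ 2 * wt)) * (4 * S) :=
        mul_le_mul_of_nonneg_right (mul_le_mul_of_nonneg_left (mul_le_mul_of_nonneg_left hwn hδh) hcf0.le) (by positivity)
      calc a * (κ₁ * (a * (δh * ((Lr ^ levY i ((shiftY i μ).symm (chartY i w.src)))⁻¹) ^ 2) * (4 * S)))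
          ≤ a * (κ₁ * (a * (δh * ((Lr ^ 2) ^ 2 * wt)) * (4 * S))) := mul_le_mul_of_nonneg_left (mul_le_mul_of_nonneg_left t1 hκ₁0) hcf0.le
        _ = a ^ 2 * (κ₁ * (4 * δh * ((Lr ^ 2) ^ 2 * wt) * S)) := by ring
  -- (C) the curvature commutator `[h,Δ′₂]Λ`: E′₁-loc at the input bond, `δ_I = δ̂c_f²L⁶wt` on the window, `G₀ = |J|`
  have hCurv : ‖O (cutCommR (hBdY i h) (hBdY i h) (curv2Y i U) Λ) b‖ ≤ m₂ * e2 * B₀ * (64 * ((d : ℝ) + 1) * δh * Lr ^ 7 * c₁) * E * S := by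
    have hC : ∀ w, ‖cutCommR (hBdY i h) (hBdY i h) (curv2Y i U) Λ w‖ ≤ a ^ 2 * (64 * ((d : ℝ) + 1) * (δh * ((Lr ^ 3) ^ 2 * wt)) * κ₁ * S) := by
      intro w
      by_cases hw0 : cutCommR (hBdY i h) (hBdY i h) (curv2Y i U) Λ w = 0
      · rw [hw0, norm_zero]; positivity
      · have hI : ∀ (p : PlaqY i) (m : Fin 4), edgeY i p m = w → ‖((i.cf ^ 2 : ℝ) : ℂ) • imHolY i U p‖ ≤ δh * (a ^ 2 * ((Lr ^ 3) ^ 2 * wt)) := by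
          intro p m hm
          refine (hI_of_plaquettes i U hU hW p).trans ?_
          rw [hcf2, mul_assoc]
          exact mul_le_mul_of_nonneg_left (mul_le_mul_of_nonneg_left (hwin (curv_window i c U Λ hw0 p m hm)) (sq_nonneg _)) hδh
        have key := norm_cutCommR_curv2Y_hTY_apply_le_loc i c U hU (by positivity) Λ w hI hS0
          (fun p m l _ => (hΛ _).trans (abs_le_supNorm_inr i J _))
        refine key.trans (le_of_eq ?_)
        ring
    have h1 := read₀ _ (by positivity) hC (fun w hw => near_curv i U Λ J hΛ ιB hι hs c hU hw)
    have e : m₂ * e2 * (B₀ * (Lx * a⁻¹) ^ 2) * E * (a ^ 2 * (64 * ((d : ℝ) + 1) * (δh * ((Lr ^ 3) ^ 2 * wt)) * κ₁ * S))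
        = m₂ * e2 * B₀ * (64 * ((d : ℝ) + 1) * δh * (Lr ^ 5 * ((κ₁ * Lr) * (Lx ^ 2 * wt)))) * E * S := by
      have := keyZ (κ₁ * wt)
      calc m₂ * e2 * (B₀ * (Lx * a⁻¹) ^ 2) * E * (a ^ 2 * (64 * ((d : ℝ) + 1) * (δh * ((Lr ^ 3) ^ 2 * wt)) * κ₁ * S))
          = m₂ * e2 * B₀ * (64 * ((d : ℝ) + 1) * δh * (Lr ^ 3) ^ 2 * ((Lx * a⁻¹) ^ 2 * (a ^ 2 * (κ₁ * wt)))) * E * S := by ring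
        _ = _ := by rw [this]; ring
    rw [e] at h1
    refine h1.trans (mul_le_mul_of_nonneg_right (mul_le_mul_of_nonneg_right (mul_le_mul_of_nonneg_left ?_ hme) hE0) hS0)
    have t1 : (κ₁ * Lr) * (Lx ^ 2 * wt) ≤ c₁ * Lr ^ 2 := mul_le_mul hκL hLxwt (by positivity) hc₁0
    have t2 : Lr ^ 5 * ((κ₁ * Lr) * (Lx ^ 2 * wt)) ≤ Lr ^ 5 * (c₁ * Lr ^ 2) := mul_le_mul_of_nonneg_left t1 (by positivity)
    have : 0 ≤ 64 * ((d : ℝ) + 1) * δh := by positivity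
    calc 64 * ((d : ℝ) + 1) * δh * (Lr ^ 5 * ((κ₁ * Lr) * (Lx ^ 2 * wt))) ≤ 64 * ((d : ℝ) + 1) * δh * (Lr ^ 5 * (c₁ * Lr ^ 2)) :=
          mul_le_mul_of_nonneg_left t2 this
      _ = _ := by ring
  -- (Q) the averaging commutator `[h,Q*aQ]Λ`: D′₃a at the input bond with the band, the column sum and the window
  set M : ℝ := Lr ^ (d + 1) with hMdef
  have hM1' : (1 : ℝ) ≤ M := one_le_pow₀ hL1
  have hM0' : (0 : ℝ) < M := lt_of_lt_of_le one_pos hM1'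
  have hLc : (((ℓ + 1 : ℕ) : ℝ)) = Lr := by rw [hLr]; push_cast; ring
  have hAvg : ‖O (cutCommR (hBdY i h) (hBdY i h) (QsY i parB U ∘ₗ aY i ∘ₗ QY i parB U) Λ) b‖
      ≤ mQ * eQ * B₀ * (4 * b₁ * Lr ^ 6 * M ^ 5 * (Cs * (Lr + 3))) * E * S := by
    have hC : ∀ w, ‖cutCommR (hBdY i h) (hBdY i h) (QsY i parB U ∘ₗ aY i ∘ₗ QY i parB U) Λ w‖
        ≤ a ^ 2 * (4 * (Cs * (Lr + 3)) * b₁ * M ^ 5 * ((Lr ^ 2) ^ 2 * wt) * S) := by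
      intro w
      by_cases hw0 : cutCommR (hBdY i h) (hBdY i h) (QsY i parB U ∘ₗ aY i ∘ₗ QY i parB U) Λ w = 0
      · rw [hw0, norm_zero]; positivity
      · obtain ⟨wup, wlo⟩ := avg_window i c parB U Λ w hw0
        -- the `P` currency on the window
        set P : ℝ := b₁ * M ^ (c.1.1 + 3) * (a ^ 2 * ((Lr ^ 2) ^ 2 * wt)) * S with hPdef
        have hAP : ∀ (y₂ : IBondY i) (f : FBondY i), qsK i w y₂ ≠ 0 → qK i y₂ f ≠ 0 → i.w y₂ * ‖Λ f‖ ≤ P := by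
          intro y₂ f hy₂ _
          have hb2 := levY_src_bounds_of_qwt_ne_zero i (qwt_ne_zero_of_qsK_ne_zero i hy₂)
          have hj1 : lvl i.hN i.D i.hk y₂ ≤ c.1.1 + 3 := by omega
          have hj2 : c.1.1 ≤ lvl i.hN i.D i.hk y₂ + 2 := by omega
          have hwb := w_le_of_band i y₂
          rw [hLc] at hwb
          have hw0' : 0 ≤ i.w y₂ := (i.hw y₂).le
          have hpow1 : (Lr ^ lvl i.hN i.D i.hk y₂) ^ (d + 1) ≤ M ^ (c.1.1 + 3) := by
            rw [hMdef, ← pow_mul, ← pow_mul, mul_comm]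
            exact pow_le_pow_right₀ hL1 (Nat.mul_le_mul_left _ hj1)
          have hpow2 : (i.cf / Lr ^ lvl i.hN i.D i.hk y₂) ^ 2 ≤ a ^ 2 * ((Lr ^ 2) ^ 2 * wt) := by
            rw [div_eq_mul_inv, mul_pow, hcf2]
            exact mul_le_mul_of_nonneg_left (inv_pow_sq_le_of_le_add hL1 hj2) (sq_nonneg _)
          have hΛf : ‖Λ f‖ ≤ S := (hΛ f).trans (abs_le_supNorm_inr i J f)
          calc i.w y₂ * ‖Λ f‖ ≤ (b₁ * (Lr ^ lvl i.hN i.D i.hk y₂) ^ (d + 1) * (i.cf / Lr ^ lvl i.hN i.D i.hk y₂) ^ 2) * S :=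
                mul_le_mul hwb hΛf (norm_nonneg _) (by positivity)
            _ ≤ (b₁ * M ^ (c.1.1 + 3) * (a ^ 2 * ((Lr ^ 2) ^ 2 * wt))) * S := by
                refine mul_le_mul_of_nonneg_right ?_ hS0
                exact mul_le_mul (mul_le_mul_of_nonneg_left hpow1 hb1) hpow2 (by positivity) (by positivity)
            _ = P := by rw [hPdef]
        have key := norm_cutCommR_QsY_aY_QY_hTY_apply_le i c parB U hT Λ w hAP
        have hcol := sum_abs_qsK_le i w
        rw [hLc] at hcol
        have hcol' : ∑ y₂, |qsK i w y₂| ≤ 2 * (M ^ 2 * (M ^ c.1.1)⁻¹) :=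
          hcol.trans (mul_le_mul_of_nonneg_left (inv_pow_le_of_le_add hM1' wlo) (by norm_num))
        have hθ : 0 ≤ 2 * (sLipT d ℓ / (Lr * i.Mh) * (Lr + 3)) * P := by positivity
        refine key.trans ((mul_le_mul_of_nonneg_left hcol' hθ).trans (le_of_eq ?_))
        rw [hPdef, hCs]
        have hMj : M ^ c.1.1 ≠ 0 := pow_ne_zero _ hM0'.ne'
        have hMpow : M ^ (c.1.1 + 3) * (M ^ 2 * (M ^ c.1.1)⁻¹) = M ^ 5 := by
          calc M ^ (c.1.1 + 3) * (M ^ 2 * (M ^ c.1.1)⁻¹) = M ^ 3 * M ^ 2 * (M ^ c.1.1 * (M ^ c.1.1)⁻¹) := by rw [pow_add]; ring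
            _ = M ^ 5 := by rw [mul_inv_cancel₀ hMj, mul_one]; ring
        calc 2 * (sLipT d ℓ / (Lr * i.Mh) * (Lr + 3)) * (b₁ * M ^ (c.1.1 + 3) * (a ^ 2 * ((Lr ^ 2) ^ 2 * wt)) * S) * (2 * (M ^ 2 * (M ^ c.1.1)⁻¹))
            = a ^ 2 * (4 * (sLipT d ℓ / (Lr * i.Mh) * (Lr + 3)) * b₁ * (M ^ (c.1.1 + 3) * (M ^ 2 * (M ^ c.1.1)⁻¹)) * ((Lr ^ 2) ^ 2 * wt) * S) := by
              ring
          _ = _ := by rw [hMpow]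
    have h1 := readQ _ (by positivity) hC (fun w hw => near_avg i Λ J hΛ ιB hι hs h parB U w hw)
    have e : mQ * eQ * (B₀ * (Lx * a⁻¹) ^ 2) * E * (a ^ 2 * (4 * (Cs * (Lr + 3)) * b₁ * M ^ 5 * ((Lr ^ 2) ^ 2 * wt) * S))
        = mQ * eQ * B₀ * (4 * b₁ * Lr ^ 4 * M ^ 5 * (Cs * (Lr + 3)) * (Lx ^ 2 * wt)) * E * S := by
      have := keyZ wt
      calc mQ * eQ * (B₀ * (Lx * a⁻¹) ^ 2) * E * (a ^ 2 * (4 * (Cs * (Lr + 3)) * b₁ * M ^ 5 * ((Lr ^ 2) ^ 2 * wt) * S))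
          = mQ * eQ * B₀ * (4 * b₁ * (Lr ^ 2) ^ 2 * M ^ 5 * (Cs * (Lr + 3)) * ((Lx * a⁻¹) ^ 2 * (a ^ 2 * wt))) * E * S := by ring
        _ = _ := by rw [this]; ring
    rw [e] at h1
    have hme' : 0 ≤ mQ * eQ * B₀ := by positivity
    refine h1.trans (mul_le_mul_of_nonneg_right (mul_le_mul_of_nonneg_right (mul_le_mul_of_nonneg_left ?_ hme') hE0) hS0)
    have : 0 ≤ 4 * b₁ * Lr ^ 4 * M ^ 5 * (Cs * (Lr + 3)) := by positivity
    calc 4 * b₁ * Lr ^ 4 * M ^ 5 * (Cs * (Lr + 3)) * (Lx ^ 2 * wt) ≤ 4 * b₁ * Lr ^ 4 * M ^ 5 * (Cs * (Lr + 3)) * Lr ^ 2 :=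
          mul_le_mul_of_nonneg_left hLxwt this
      _ = _ := by ring
  -- assemble
  have hsum : ∀ {f : Fin (d + 1) → ℝ} {C : ℝ}, (∀ μ, f μ ≤ C) → ∑ μ, f μ ≤ ((d : ℝ) + 1) * C := fun {f C} hf => by
    calc ∑ μ, f μ ≤ ∑ _μ : Fin (d + 1), C := Finset.sum_le_sum fun μ _ => hf μ
      _ = ((d : ℝ) + 1) * C := by rw [Finset.sum_const, Finset.card_univ, Fintype.card_fin, nsmul_eq_mul]; push_cast; ring
  have n1 : ‖∑ μ : Fin (d + 1), O (cdsB i U μ (dCurl i h U Λ μ)) b‖ ≤ ((d : ℝ) + 1) * (m₂ * e2 * B₀ * (2 * c₁) * E * S) :=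
    (norm_sum_le _ _).trans (hsum hD1)
  have n2 : ‖∑ μ : Fin (d + 1), O (cdsB i U μ (Jb i U μ (dDiv i h U Λ))) b‖ ≤ ((d : ℝ) + 1) * (m₂ * e2 * B₀ * (((d : ℝ) + 1) * c₁) * E * S) :=
    (norm_sum_le _ _).trans (hsum hD2)
  have n3 : ‖∑ μ : Fin (d + 1), O (cdsB i U μ (dMul i h Λ μ)) b‖ ≤ ((d : ℝ) + 1) * (m₂ * e2 * B₀ * c₁ * E * S) :=
    (norm_sum_le _ _).trans (hsum hD3)
  have n4 : ‖∑ μ : Fin (d + 1), ∑ lam : Fin (d + 1), O (cdsB i U lam (Jb i U lam (dBwd i h U Λ μ))) b‖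
      ≤ ((d : ℝ) + 1) * (((d : ℝ) + 1) * (m₂ * e2 * B₀ * c₁ * E * S)) :=
    (norm_sum_le _ _).trans (hsum fun μ => (norm_sum_le _ _).trans (hsum (hD4 μ)))
  have n5 : ‖∑ μ : Fin (d + 1), O (cdsB i U μ (dFwd i h U Λ μ)) b‖ ≤ ((d : ℝ) + 1) * (m₂ * e2 * B₀ * c₁ * E * S) :=
    (norm_sum_le _ _).trans (hsum hD5)
  have n6 : ‖∑ μ : Fin (d + 1), (O (zSec i h U Λ μ) b + O (zMixB i h U Λ μ) b + O (zHolB i h U Λ μ) b + O (zJor i h U Λ μ) b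
        + O (zMixF i h U Λ μ) b + O (zHolF i h U Λ μ) b)‖
      ≤ ((d : ℝ) + 1) * (m₂ * e2 * B₀ * (c₂ + 2 * c₂ₓ + 8 * δh * Lr ^ 5 * c₁) * E * S) := by
    refine (norm_sum_le _ _).trans (hsum fun μ => ?_)
    have := norm_add_le_of_le (norm_add_le_of_le (norm_add_le_of_le (norm_add_le_of_le (norm_add_le_of_le (hZ1 μ) (hZ2 μ)) (hZ3 μ)) (hZ4 μ))
      (hZ5 μ)) (hZ6 μ)
    refine this.trans (le_of_eq ?_)
    ring
  rw [cutMulY_apply, hBdY_apply, ← hx₀, norm_smul, Complex.norm_real, Real.norm_eq_abs, hOK]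
  have htot := norm_add_le_of_le (norm_add_le_of_le (norm_add_le_of_le (norm_add_le_of_le (norm_add_le_of_le (norm_add_le_of_le
    (norm_add_le_of_le n1 n2) n3) n4) n5) n6) hCurv) hAvg
  have hX0 : 0 ≤ ‖(∑ μ : Fin (d + 1), O (cdsB i U μ (dCurl i h U Λ μ)) b)
        + (∑ μ : Fin (d + 1), O (cdsB i U μ (Jb i U μ (dDiv i h U Λ))) b)
        + (∑ μ : Fin (d + 1), O (cdsB i U μ (dMul i h Λ μ)) b)
        + (∑ μ : Fin (d + 1), ∑ lam : Fin (d + 1), O (cdsB i U lam (Jb i U lam (dBwd i h U Λ μ))) b)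
        + (∑ μ : Fin (d + 1), O (cdsB i U μ (dFwd i h U Λ μ)) b)
        + (∑ μ : Fin (d + 1), (O (zSec i h U Λ μ) b + O (zMixB i h U Λ μ) b + O (zHolB i h U Λ μ) b + O (zJor i h U Λ μ) b
            + O (zMixF i h U Λ μ) b + O (zHolF i h U Λ μ) b))
        + O (cutCommR (hBdY i h) (hBdY i h) (curv2Y i U) Λ) b
        + O (cutCommR (hBdY i h) (hBdY i h) (QsY i parB U ∘ₗ aY i ∘ₗ QY i parB U) Λ) b‖ := norm_nonneg _
  refine (mul_le_mul hh1 htot hX0 zero_le_one).trans (le_of_eq ?_)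
  rw [one_mul, hc₂, hc₂ₓ]
  ring

end Main

end Literature.MathematicalPhysics.QuantumFieldTheory.Balaban1983to89.B9Thm310TransposedCommutatorB

end
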